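import Literature.Analysis.FluidPDE.LocalPressureLiouvilleFunctional
import Literature.Analysis.FluidPDE.PressureEquationSlicing
import Literature.Analysis.FluidPDE.HarmonicVanishing
import Literature.Analysis.FluidPDE.HarmonicLiouvilleLp
import Literature.Analysis.FluidPDE.HelmholtzAnnihilator
import Literature.Analysis.FunctionSpaces.Mollification
import Mathlib.Analysis.Distribution.AEEqOfIntegralContDiff
import HarnessLib

/-!
# The Liouville step for the pressure of a local Leray solution on a slab: the mollified
pressure-gradient functional vanishes identically, and its time slices vanish a.e.

Analysis/FluidPDE support file (theorems only, everything PROVED) on the discharge path of the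
named fact `Literature.Analysis.FluidPDE.kangMiuraTsai_local_pressure_bound`
(`LocalLerayPressureBound.lean`; Kang–Miura–Tsai, IMRN 2021 = arXiv:1812.10509, the bound
printed in the proof of Lemma 3.4, §8), third layer above `LocalPressureLiouvilleKernel.lean`
and `LocalPressureLiouvilleFunctional.lean`.

For a local Leray solution `(v, π)` on `(0,T) × ℝ³` (`IsLocalLeraySolutionOn`), a time test
function `η ∈ C_c^∞((0,T))`, a direction `e` and the bump `λ_δ = ΔΦ_δ` (`Φ_δ = newtonReg δ`), the
functional of the previous file,
`F(c) = ∫∫ η(t) [π ∂ₑλ_δ(c - x) + D³Φ_δ(c - x)(e)(v, v)] dx dt`, is continuous and tends to `0`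
at spatial infinity. Here:

* `laplacian_normed_convolution_pgFunctional_eq_zero` — **every mollification `ψ ⋆ F` of `F` is
  harmonic** (`ψ = φ.normed` a Mathlib bump): `Δ(ψ ⋆ F)(b) = ∫ Δψ(s) F(b - s) ds`
  (`laplacian_convolution_lsmul`), the `s`-integral is exchanged with the slab integral, and on
  each space–time point the Laplacian is moved from the bump `ψ` onto the profile: with the
  smooth compactly supported `σ = ψ ⋆ λ_δ` and the test function `θ(y) = ∂ₑσ(b - y)`, the
  result is `∫∫ η(t) [π(t,x) Δθ(x) + D²θ(x)(v, v)] dx dt`, which vanishes by the **pressure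
  Poisson equation on a.e. time slice** (`ae_forall_slice_pressure_identity`,
  `PressureEquationSlicing.lean`) — the identity `ΔΦ_δ = λ_δ` replaces every Newtonian potential
  by an explicit smooth function, so that no singular integral occurs;
* `pgFunctional_eq_zero` — **Liouville**: `ψ ⋆ F` is harmonic on `ℝ³` and tends to `0` at
  infinity, hence vanishes (`harmonic_eq_zero_of_tendsto_cocompact`), and `F = lim ψₙ ⋆ F = 0`
  (`ContDiffBump.convolution_tendsto_right_of_continuous`);
* `ae_slice_pgIdentity` — **time slicing**: since `F = ∫ η(t) g_c(t) dt` vanishes for every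
  `η ∈ C_c^∞((0,T))`, the slice functional
  `g_c(t) = ∫ [π(t) ∂ₑλ_δ(c - ·) + D³Φ_δ(c - ·)(e)(v(t), v(t))] dx` vanishes for a.e. `t`, for all
  `δ = 1/(n+1)`, all centres `c` and all directions `e` (countably many first, then all by
  continuity in `c` and linearity in `e`), together with the standing properties of a.e. slice
  (measurability, `|v(t)|², π(t) ∈ L¹_loc`, the uniformly local energy bound, the slice pressure
  equation) that the oscillation estimate of the sequel consumes.

This is the tree's form of the statement "`∇π = ∇(p_loc + p_far)` in `𝒟'`" behind the local
pressure expansion of Jia–Šverák / Kang–Miura–Tsai (Lemma 3.4) and of the characterisation of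
the pressure by Fernández-Dalgo–Lemarié-Rieusset (Thm. 1): on a.e. time slice, the
`λ_δ`-mollified pressure gradient equals the `λ_δ`-mollified gradient of the whole-space
pressure `RᵢRⱼ(vᵢvⱼ)`, the latter written through the explicit potential `Φ_δ`.

## Mathlib / tree search

Tree: `laplacian_convolution_lsmul`, `fderiv_laplacian_apply`, `fderiv_fderiv_apply_comm`
(`HelmholtzAnnihilator`); `contDiff_integral_smul_comp_sub`, `fderiv_integral_smul_comp_sub_apply`,
`laplacian_integral_mul_comp_sub`, `laplacian_comp_const_sub`, `fderiv2_comp_const_sub`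
(`HarmonicProbe`); `harmonicOnNhd_of_laplacian_eq_zero` (`HarmonicLiouvilleLp`),
`harmonic_eq_zero_of_tendsto_cocompact` (`HarmonicVanishing`);
`IsDistributionalNSSolutionOn.ae_forall_slice_pressure_identity` (`PressureEquationSlicing`);
`FunctionSpaces.exists_contDiffBump_seq` (`Mollification`); the two previous layers. Mathlib:
`ContDiffBump.convolution_tendsto_right_of_continuous`, `HasCompactSupport.contDiff_convolution_left`,
`IsOpen.ae_eq_zero_of_integral_contDiff_smul_eq_zero`, `integral_integral_swap`,
`TopologicalSpace.denseSeq`, `Continuous.ext_on`.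

## References

* P. G. Fernández-Dalgo, P. G. Lemarié-Rieusset, DCDS-S 14 (2021) = arXiv:2001.10436, Thm. 1
  and §5 (the harmonic correction is a constant in `x`). [`FernandezdalgoLemarierieusset2021`]
* K. Kang, H. Miura, T.-P. Tsai, IMRN 2021 = arXiv:1812.10509, Lemma 3.4 and §8 (the Liouville
  argument for `v - v̄`). [`KangMiuraTsai2020`]
* H. Jia, V. Šverák, Invent. Math. 196 (2014) = arXiv:1204.0529, §3. [`JiaSverak2014`]
-/

noncomputable section

open MeasureTheory Set Filter Topology Function Metric
open scoped ENNReal NNReal RealInnerProductSpace Laplacian Convolution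

namespace Literature.Analysis.FluidPDE

-- nested operator types `ℝ³ →L[ℝ] ℝ³ →L[ℝ] ℝ³ →L[ℝ] ℝ`
set_option maxSynthPendingDepth 3

/-! ## Almost every time slice of a local Leray solution -/

section GoodTimes

variable {T ν : ℝ} {v₀ : EuclideanSpace ℝ (Fin 3) → EuclideanSpace ℝ (Fin 3)}
  {v : ℝ → EuclideanSpace ℝ (Fin 3) → EuclideanSpace ℝ (Fin 3)}
  {π : ℝ → EuclideanSpace ℝ (Fin 3) → ℝ}

/-- Local integrability on `ℝ³` from integrability on all closed balls about the origin.
[folklore] -/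
theorem locallyIntegrable_of_forall_closedBall {F : Type*} [NormedAddCommGroup F]
    {f : EuclideanSpace ℝ (Fin 3) → F}
    (h : ∀ n : ℕ, IntegrableOn f (closedBall (0 : EuclideanSpace ℝ (Fin 3)) n) volume) :
    LocallyIntegrable f volume := by
  refine (locallyIntegrable_iff).2 fun K hK => ?_
  obtain ⟨r, hr⟩ := hK.isBounded.subset_closedBall (0 : EuclideanSpace ℝ (Fin 3))
  obtain ⟨n, hn⟩ := exists_nat_ge r
  exact (h n).mono_set (hr.trans (closedBall_subset_closedBall hn))

namespace IsLocalLeraySolutionOn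

/-- For a.e. `t ∈ (0,T)`, the slice `|v(t)|²` is locally integrable on `ℝ³` (Tonelli on the
boxes `(0,T) × B̄(0,n)`, where `v ∈ L²`). [folklore] -/
theorem ae_locallyIntegrable_norm_sq_slice (hv : IsLocalLeraySolutionOn T ν v₀ v π) :
    ∀ᵐ t ∂(volume.restrict (Ioo (0 : ℝ) T)),
      LocallyIntegrable (fun x => ‖v t x‖ ^ 2) volume := by
  set μt : Measure ℝ := volume.restrict (Ioo (0 : ℝ) T) with hμt
  have hvm := hv.aestronglyMeasurable_prod
  have hball : ∀ n : ℕ, ∀ᵐ t ∂μt,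
      IntegrableOn (fun x => ‖v t x‖ ^ 2) (closedBall (0 : EuclideanSpace ℝ (Fin 3)) n) volume := by
    intro n
    set K : Set (EuclideanSpace ℝ (Fin 3)) := closedBall 0 n with hK
    set μK : Measure (EuclideanSpace ℝ (Fin 3)) := volume.restrict K with hμK
    have hprod : μt.prod μK = volume.restrict (Ioo (0 : ℝ) T ×ˢ K) := by
      rw [hμt, hμK, Measure.prod_restrict, ← Measure.volume_eq_prod]
    have hvmK : AEStronglyMeasurable (uncurry v) (μt.prod μK) :=
      hvm.mono_measure (Measure.prod_mono le_rfl Measure.restrict_le_self)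
    have hG : AEMeasurable (fun z : ℝ × EuclideanSpace ℝ (Fin 3) => ‖v z.1 z.2‖ₑ ^ 2) (μt.prod μK) :=
      hvmK.enorm.pow_const _
    have hfin : ∫⁻ t, ∫⁻ x, ‖v t x‖ₑ ^ 2 ∂μK ∂μt < ⊤ := by
      rw [← lintegral_prod _ hG, hprod]
      exact hv.sqIntegrable K (isCompact_closedBall _ _)
    have hslice : ∀ᵐ t ∂μt, ∫⁻ x, ‖v t x‖ₑ ^ 2 ∂μK < ⊤ := ae_lt_top' hG.lintegral_prod_right' hfin.ne
    have hmeas : ∀ᵐ t ∂μt, AEStronglyMeasurable (v t) μK := by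
      filter_upwards [hvmK.prodMk_left] with t ht
      exact ht
    filter_upwards [hslice, hmeas] with t ht hmt
    have hmem : MemLp (v t) 2 μK := by
      refine ⟨hmt, ?_⟩
      rw [eLpNorm_eq_lintegral_rpow_enorm_toReal (by norm_num) (by norm_num), ENNReal.toReal_ofNat]
      have e2 : ∀ y : ℝ≥0∞, y ^ (2 : ℝ) = y ^ (2 : ℕ) := fun y => by
        rw [show (2 : ℝ) = ((2 : ℕ) : ℝ) by norm_num, ENNReal.rpow_natCast]
      simp_rw [e2]
      exact ENNReal.rpow_lt_top_of_nonneg (by norm_num) ht.ne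
    exact (memLp_two_iff_integrable_sq_norm hmt).1 hmem
  have hall : ∀ᵐ t ∂μt, ∀ n : ℕ,
      IntegrableOn (fun x => ‖v t x‖ ^ 2) (closedBall (0 : EuclideanSpace ℝ (Fin 3)) n) volume :=
    ae_all_iff.2 hball
  filter_upwards [hall] with t ht
  exact locallyIntegrable_of_forall_closedBall ht

/-- For a.e. `t ∈ (0,T)`, the pressure slice `π(t)` is locally integrable on `ℝ³` (it is in
`L^{3/2}` of every box `(0,T) × B̄(0,n)`). [folklore] -/
theorem ae_locallyIntegrable_pressure_slice (hv : IsLocalLeraySolutionOn T ν v₀ v π) :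
    ∀ᵐ t ∂(volume.restrict (Ioo (0 : ℝ) T)), LocallyIntegrable (π t) volume := by
  set μt : Measure ℝ := volume.restrict (Ioo (0 : ℝ) T) with hμt
  have hπm : AEStronglyMeasurable (uncurry π) (μt.prod volume) := by
    rw [← volume_restrict_slab_eq_prod]
    exact hv.aestronglyMeasurable_pressure
  have h32_0 : (3 / 2 : ℝ≥0∞) ≠ 0 := by norm_num
  have h32_t : (3 / 2 : ℝ≥0∞) ≠ ⊤ := (ENNReal.div_lt_top ENNReal.ofNat_ne_top two_ne_zero).ne
  have h32 : (3 / 2 : ℝ≥0∞).toReal = 3 / 2 := by rw [ENNReal.toReal_div]; norm_num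
  have h1le : (1 : ℝ≥0∞) ≤ 3 / 2 := by
    rw [ENNReal.le_div_iff_mul_le (Or.inl two_ne_zero) (Or.inl ENNReal.ofNat_ne_top)]; norm_num
  have hball : ∀ n : ℕ, ∀ᵐ t ∂μt,
      IntegrableOn (π t) (closedBall (0 : EuclideanSpace ℝ (Fin 3)) n) volume := by
    intro n
    set K : Set (EuclideanSpace ℝ (Fin 3)) := closedBall 0 n with hK
    set μK : Measure (EuclideanSpace ℝ (Fin 3)) := volume.restrict K with hμK
    haveI : IsFiniteMeasure μK :=
      ⟨by rw [hμK, Measure.restrict_apply_univ]; exact measure_closedBall_lt_top⟩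
    have hprod : μt.prod μK = volume.restrict (Ioo (0 : ℝ) T ×ˢ K) := by
      rw [hμt, hμK, Measure.prod_restrict, ← Measure.volume_eq_prod]
    have hπmK : AEStronglyMeasurable (uncurry π) (μt.prod μK) :=
      hπm.mono_measure (Measure.prod_mono le_rfl Measure.restrict_le_self)
    have hG : AEMeasurable (fun z : ℝ × EuclideanSpace ℝ (Fin 3) => ‖π z.1 z.2‖ₑ ^ (3 / 2 : ℝ))
        (μt.prod μK) := hπmK.enorm.pow_const _
    have hfin : ∫⁻ t, ∫⁻ x, ‖π t x‖ₑ ^ (3 / 2 : ℝ) ∂μK ∂μt < ⊤ := by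
      rw [← lintegral_prod _ hG, hprod]
      exact hv.pressure K (isCompact_closedBall _ _)
    have hslice : ∀ᵐ t ∂μt, ∫⁻ x, ‖π t x‖ₑ ^ (3 / 2 : ℝ) ∂μK < ⊤ :=
      ae_lt_top' hG.lintegral_prod_right' hfin.ne
    have hmeas : ∀ᵐ t ∂μt, AEStronglyMeasurable (π t) μK := by
      filter_upwards [hπmK.prodMk_left] with t ht
      exact ht
    filter_upwards [hslice, hmeas] with t ht hmt
    have hmem : MemLp (π t) (3 / 2) μK := by
      refine ⟨hmt, ?_⟩
      rw [eLpNorm_eq_lintegral_rpow_enorm_toReal h32_0 h32_t, h32]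
      exact ENNReal.rpow_lt_top_of_nonneg (by norm_num) ht.ne
    exact hmem.integrable h1le
  have hall : ∀ᵐ t ∂μt, ∀ n : ℕ,
      IntegrableOn (π t) (closedBall (0 : EuclideanSpace ℝ (Fin 3)) n) volume := ae_all_iff.2 hball
  filter_upwards [hall] with t ht
  exact locallyIntegrable_of_forall_closedBall ht

/-- **The pressure Poisson equation on a.e. time slice** of a local Leray solution on the slab:
for a.e. `t ∈ (0,T)` and every test function `ψ` on `ℝ³`,
`∫ π(t) Δψ = -∫ D²ψ(v(t), v(t))` (`ae_forall_slice_pressure_identity` for the region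
`(0,T) × ℝ³`, no force). [cite: KangMiuraTsai2020, Def. 3.1 (1) (distributional solution); Seregin2014 §6.3] -/
theorem ae_slice_pressure_poisson (hv : IsLocalLeraySolutionOn T ν v₀ v π) :
    ∀ᵐ t ∂(volume.restrict (Ioo (0 : ℝ) T)),
      ∀ ψ : EuclideanSpace ℝ (Fin 3) → ℝ,
        FunctionSpaces.IsTestFunctionOn (⊤ : TopologicalSpace.Opens (EuclideanSpace ℝ (Fin 3))) ψ →
          ∫ x, π t x * Δ ψ x = -∫ x, fderiv ℝ (fderiv ℝ ψ) x (v t x) (v t x) := by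
  -- the slab as a product region `(0,T) × ⊤`
  set Q' : TopologicalSpace.Opens (ℝ × EuclideanSpace ℝ (Fin 3)) :=
    ⟨Ioo (0 : ℝ) T ×ˢ ((⊤ : TopologicalSpace.Opens (EuclideanSpace ℝ (Fin 3))) :
      Set (EuclideanSpace ℝ (Fin 3))), isOpen_Ioo.prod (⊤ : TopologicalSpace.Opens _).isOpen⟩ with hQ'
  have hQeq : Q' = slab (EuclideanSpace ℝ (Fin 3)) (Ioo 0 T) isOpen_Ioo := by
    ext z
    simp [hQ']
  have hns : IsDistributionalNSSolutionOn Q' ν 0 v π := by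
    rw [hQeq]; exact hv.distributional
  have hf0 : LocallyIntegrableOn
      (uncurry (0 : ℝ → EuclideanSpace ℝ (Fin 3) → EuclideanSpace ℝ (Fin 3)))
      (Ioo (0 : ℝ) T ×ˢ ((⊤ : TopologicalSpace.Opens (EuclideanSpace ℝ (Fin 3))) :
        Set (EuclideanSpace ℝ (Fin 3)))) volume := locallyIntegrableOn_const _
  have hdiv0 : ∀ φ : ℝ → EuclideanSpace ℝ (Fin 3) → ℝ, IsSpaceTimeTestOn Q' φ →
      ∫ z in Ioo (0 : ℝ) T ×ˢ ((⊤ : TopologicalSpace.Opens (EuclideanSpace ℝ (Fin 3))) :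
        Set (EuclideanSpace ℝ (Fin 3))),
        ⟪(0 : ℝ → EuclideanSpace ℝ (Fin 3) → EuclideanSpace ℝ (Fin 3)) z.1 z.2,
          gradient (φ z.1) z.2⟫ = 0 := fun φ _ => by simp
  have hid := hns.ae_forall_slice_pressure_identity hf0 hdiv0
  filter_upwards [hid, hv.ae_aestronglyMeasurable_slice', hv.ae_locallyIntegrable_norm_sq_slice,
    hv.ae_locallyIntegrable_pressure_slice] with t ht hmt hu2 hp ψ hψ
  refine ht ?_ ?_ ?_ ψ hψ
  · rw [TopologicalSpace.Opens.coe_top, Measure.restrict_univ]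
    exact hmt
  · rw [TopologicalSpace.Opens.coe_top, locallyIntegrableOn_univ]
    exact hu2
  · rw [TopologicalSpace.Opens.coe_top, locallyIntegrableOn_univ]
    exact hp

end IsLocalLeraySolutionOn

end GoodTimes

/-! ## Calculus of bump averages `P[ψ, g](w) = ∫ ψ(s) g(w - s) ds` -/

section BumpAverage

variable (φ : ContDiffBump (0 : EuclideanSpace ℝ (Fin 3)))

/-- The normalised bump vanishes off the ball of radius `rOut`. [folklore] -/
theorem normed_eq_zero_of_lt {z : EuclideanSpace ℝ (Fin 3)} (hz : φ.rOut < ‖z‖) :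
    φ.normed volume z = 0 := by
  have h : z ∉ Function.support (φ.normed volume) := by
    rw [φ.support_normed_eq, mem_ball_zero_iff, not_lt]
    exact hz.le
  simpa [Function.mem_support] using h

/-- Smoothness of bump averages of smooth functions (derivatives fall on the function).
[folklore] -/
theorem contDiff_integral_normed_mul_comp_sub (n : ℕ) {g : EuclideanSpace ℝ (Fin 3) → ℝ}
    (hg : ContDiff ℝ n g) : ContDiff ℝ n fun w => ∫ s, φ.normed volume s * g (w - s) := by
  have h := contDiff_integral_smul_comp_sub (F := ℝ) φ.integrable_normed
    (fun _ hz => normed_eq_zero_of_lt φ hz) n hg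
  simpa only [smul_eq_mul] using h

/-- Directional derivatives of bump averages: `∂ₐ P[ψ, g] = P[ψ, ∂ₐ g]`. [folklore] -/
theorem fderiv_integral_normed_mul_comp_sub_apply {g : EuclideanSpace ℝ (Fin 3) → ℝ}
    (hg : ContDiff ℝ 1 g) (w a : EuclideanSpace ℝ (Fin 3)) :
    fderiv ℝ (fun w => ∫ s, φ.normed volume s * g (w - s)) w a =
      ∫ s, φ.normed volume s * fderiv ℝ g (w - s) a := by
  have h := fderiv_integral_smul_comp_sub_apply (F := ℝ) φ.integrable_normed
    (fun _ hz => normed_eq_zero_of_lt φ hz) hg w a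
  simpa only [smul_eq_mul] using h

/-- The Laplacian of a bump average falls on the function: `Δ P[ψ, g] = P[ψ, Δg]`. [folklore] -/
theorem laplacian_integral_normed_mul_comp_sub {g : EuclideanSpace ℝ (Fin 3) → ℝ}
    (hg : ContDiff ℝ 2 g) (w : EuclideanSpace ℝ (Fin 3)) :
    Δ (fun w => ∫ s, φ.normed volume s * g (w - s)) w = ∫ s, φ.normed volume s * Δ g (w - s) :=
  laplacian_integral_mul_comp_sub φ.integrable_normed (fun _ hz => normed_eq_zero_of_lt φ hz) hg w

/-- The Laplacian of a bump average also falls on the bump: `P[Δψ, g] = Δ P[ψ, g]` for a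
continuous `g` (`Δ(ψ ⋆ g) = (Δψ) ⋆ g`, `laplacian_convolution_lsmul`). [folklore] -/
theorem integral_laplacian_normed_mul_comp_sub {g : EuclideanSpace ℝ (Fin 3) → ℝ}
    (hg : Continuous g) (w : EuclideanSpace ℝ (Fin 3)) :
    ∫ s, Δ (φ.normed volume) s * g (w - s) = Δ (fun w => ∫ s, φ.normed volume s * g (w - s)) w := by
  have h1 : (fun w => ∫ s, φ.normed volume s * g (w - s)) =
      (φ.normed volume ⋆[ContinuousLinearMap.lsmul ℝ ℝ, volume] g) := by
    funext w
    rw [convolution_lsmul_apply]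
  rw [h1, laplacian_convolution_lsmul φ.contDiff_normed φ.hasCompactSupport_normed
    hg.locallyIntegrable w, convolution_lsmul_apply]

/-- Bump averages of compactly supported functions are compactly supported: if `g = 0` off
`B̄(0, R)` then `P[ψ, g] = 0` off `B̄(0, R + rOut)`. [folklore] -/
theorem integral_normed_mul_comp_sub_eq_zero {g : EuclideanSpace ℝ (Fin 3) → ℝ} {R : ℝ}
    (hg : ∀ z, R < ‖z‖ → g z = 0) {w : EuclideanSpace ℝ (Fin 3)} (hw : R + φ.rOut < ‖w‖) :
    ∫ s, φ.normed volume s * g (w - s) = 0 := by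
  refine integral_eq_zero_of_ae (Eventually.of_forall fun s => ?_)
  by_cases hs : φ.rOut < ‖s‖
  · simp [normed_eq_zero_of_lt φ hs]
  · have hws : R < ‖w - s‖ := by
      have := norm_sub_norm_le w s
      push Not at hs
      linarith
    simp [hg _ hws]

end BumpAverage

/-! ## Third derivatives: pure/iterated conversions and commutation -/

section ThirdDerivatives

/-- For a `C³` function, `D³f(z)(e)(a)(a) = ∂ₑ(∂ₐ∂ₐ f)(z)`. [folklore] -/
theorem fderiv3_apply_apply_self {f : EuclideanSpace ℝ (Fin 3) → ℝ} (hf : ContDiff ℝ 3 f)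
    (z e a : EuclideanSpace ℝ (Fin 3)) :
    fderiv ℝ (fderiv ℝ (fderiv ℝ f)) z e a a =
      fderiv ℝ (fun s => fderiv ℝ (fun r => fderiv ℝ f r a) s a) z e := by
  have hd1 : Differentiable ℝ (fderiv ℝ f) :=
    (hf.fderiv_right (m := 2) (by norm_num)).differentiable (by norm_num)
  have hd2 : Differentiable ℝ (fderiv ℝ (fderiv ℝ f)) :=
    ((hf.fderiv_right (m := 2) (by norm_num)).fderiv_right (m := 1) (by norm_num)).differentiable
      (by norm_num)
  have hfun : (fun s => fderiv ℝ (fun r => fderiv ℝ f r a) s a) =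
      fun s => evalDiag a (fderiv ℝ (fderiv ℝ f) s) := by
    funext s
    rw [evalDiag_apply, FluidPDE.fderiv_apply_const_apply (hd1 s)]
  have hcomp : HasFDerivAt (fun s => evalDiag a (fderiv ℝ (fderiv ℝ f) s))
      ((evalDiag a).comp (fderiv ℝ (fderiv ℝ (fderiv ℝ f)) z)) z :=
    (evalDiag a).hasFDerivAt.comp z (hd2 z).hasFDerivAt
  rw [hfun, hcomp.fderiv]
  rfl

/-- Commutation of the three directional derivatives: `∂ₑ∂ₐ∂ₐ f = ∂ₐ∂ₐ∂ₑ f` for `f ∈ C³`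
(Schwarz twice). [folklore] -/
theorem fderiv3_comm {f : EuclideanSpace ℝ (Fin 3) → ℝ} (hf : ContDiff ℝ 3 f)
    (z e a : EuclideanSpace ℝ (Fin 3)) :
    fderiv ℝ (fun s => fderiv ℝ (fun r => fderiv ℝ f r a) s a) z e =
      fderiv ℝ (fun s => fderiv ℝ (fun r => fderiv ℝ f r e) s a) z a := by
  have hfa : ContDiff ℝ 2 (fun r => fderiv ℝ f r a) :=
    (hf.fderiv_right (m := 2) (by norm_num)).clm_apply contDiff_const
  rw [fderiv_fderiv_apply_comm hfa z e a]
  have hFG : (fun y => fderiv ℝ (fun r => fderiv ℝ f r a) y e) =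
      fun s => fderiv ℝ (fun r => fderiv ℝ f r e) s a := by
    funext s
    exact fderiv_fderiv_apply_comm (hf.of_le (by norm_num)) s e a
  rw [hFG]

end ThirdDerivatives

/-! ## The mollified potential and bump profile -/

section MollifiedProfile

variable (φ : ContDiffBump (0 : EuclideanSpace ℝ (Fin 3))) {δ : ℝ}

/-- **Moving the Laplacian from the bump to the pressure side.** With the bump average
`σ = P[ψ, λ_δ]` of the profile `λ_δ = ΔΦ_δ`,
`∫ Δψ(s) ∂ₑλ_δ(b - s - x) ds = ∂ₑ(Δσ)(b - x)`. [folklore] -/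
theorem integral_laplacian_normed_mul_fderiv_laplacian_newtonReg (hδ : 0 < δ)
    (b x e : EuclideanSpace ℝ (Fin 3)) :
    ∫ s, Δ (φ.normed volume) s * fderiv ℝ (Δ (newtonReg δ)) (b - s - x) e =
      fderiv ℝ (Δ (fun w => ∫ s, φ.normed volume s * Δ (newtonReg δ) (w - s))) (b - x) e := by
  set lam : EuclideanSpace ℝ (Fin 3) → ℝ := Δ (newtonReg δ) with hlam
  -- smoothness of the profile (explicit finite orders)
  have hl1 : ContDiff ℝ 1 lam := by
    rw [hlam, laplacian_newtonReg hδ]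
    exact contDiff_newtonFarLaplacian (half_pos_lt hδ).1 (half_pos_lt hδ).2
  have hl3 : ContDiff ℝ 3 lam := by
    rw [hlam, laplacian_newtonReg hδ]
    exact contDiff_newtonFarLaplacian (half_pos_lt hδ).1 (half_pos_lt hδ).2
  -- `∫ Δψ(s) ∂ₑλ(w - s) = Δ (P[ψ, ∂ₑλ]) w = Δ (∂ₑ P[ψ, λ]) w = ∂ₑ (Δ P[ψ, λ]) w`
  have hge : Continuous fun w => fderiv ℝ lam w e :=
    (hl1.continuous_fderiv one_ne_zero).clm_apply continuous_const
  simp_rw [sub_right_comm b _ x]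
  rw [integral_laplacian_normed_mul_comp_sub φ hge]
  have hP : (fun w => ∫ s, φ.normed volume s * fderiv ℝ lam (w - s) e) =
      fun w => fderiv ℝ (fun w' => ∫ s, φ.normed volume s * lam (w' - s)) w e := by
    funext w
    rw [fderiv_integral_normed_mul_comp_sub_apply φ hl1 w e]
  rw [hP, ← fderiv_laplacian_apply (contDiff_integral_normed_mul_comp_sub φ 3 hl3)]

/-- **Moving the Laplacian from the bump to the velocity side.** With `σ = P[ψ, λ_δ]`,
`∫ Δψ(s) D³Φ_δ(b - s - x)(e)(a, a) ds = ∂ₐ∂ₐ∂ₑ σ(b - x)` — the Laplacian hitting the mollified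
potential `P[ψ, Φ_δ]` produces `σ`, because `ΔΦ_δ = λ_δ`. [folklore] -/
theorem integral_laplacian_normed_mul_evalDiag_fderiv3_newtonReg (hδ : 0 < δ)
    (b x e a : EuclideanSpace ℝ (Fin 3)) :
    ∫ s, Δ (φ.normed volume) s *
        evalDiag a (fderiv ℝ (fderiv ℝ (fderiv ℝ (newtonReg δ))) (b - s - x) e) =
      fderiv ℝ (fun w => fderiv ℝ (fun w' =>
        fderiv ℝ (fun w'' => ∫ s, φ.normed volume s * Δ (newtonReg δ) (w'' - s)) w' e) w a)
          (b - x) a := by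
  set Φ : EuclideanSpace ℝ (Fin 3) → ℝ := newtonReg δ with hΦ
  have hΦ5 : ContDiff ℝ 5 Φ := contDiff_newtonReg δ (n := 5)
  -- the pure second derivative `h_a = ∂ₐ∂ₐΦ` and the mollified potential `Σ = P[ψ, Φ]`
  set Φa : EuclideanSpace ℝ (Fin 3) → ℝ := fun r => fderiv ℝ Φ r a with hΦa
  set ha : EuclideanSpace ℝ (Fin 3) → ℝ := fun s => fderiv ℝ Φa s a with hha
  have hΦa4 : ContDiff ℝ 4 Φa := (hΦ5.fderiv_right (m := 4) (by norm_num)).clm_apply contDiff_const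
  have hha3 : ContDiff ℝ 3 ha := (hΦa4.fderiv_right (m := 3) (by norm_num)).clm_apply contDiff_const
  set Sig : EuclideanSpace ℝ (Fin 3) → ℝ := fun w => ∫ s, φ.normed volume s * Φ (w - s) with hSig
  have hSig5 : ContDiff ℝ 5 Sig := contDiff_integral_normed_mul_comp_sub φ 5 hΦ5
  -- `ΔΣ = P[ψ, ΔΦ] = σ`
  have hΔSig : Δ Sig = fun w => ∫ s, φ.normed volume s * Δ (newtonReg δ) (w - s) := by
    funext w
    rw [hSig, laplacian_integral_normed_mul_comp_sub φ (hΦ5.of_le (by norm_num)) w]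
  -- rewrite the integrand through `h_a`
  have hint : ∀ s, evalDiag a (fderiv ℝ (fderiv ℝ (fderiv ℝ Φ)) (b - s - x) e) =
      fderiv ℝ ha (b - x - s) e := by
    intro s
    rw [evalDiag_apply, sub_right_comm b s x, hha, hΦa, hΦ, fderiv3_newtonReg_apply_apply_self]
  simp_rw [hint]
  -- `∫ Δψ(s) ∂ₑ h_a(w - s) = Δ(P[ψ, ∂ₑ h_a]) w = Δ(∂ₑ P[ψ, h_a]) w = ∂ₑ Δ(P[ψ, h_a]) w`
  have hge : Continuous fun w => fderiv ℝ ha w e :=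
    ((hha3.continuous_fderiv (by norm_num))).clm_apply continuous_const
  rw [integral_laplacian_normed_mul_comp_sub φ hge]
  have hP1 : (fun w => ∫ s, φ.normed volume s * fderiv ℝ ha (w - s) e) =
      fun w => fderiv ℝ (fun w' => ∫ s, φ.normed volume s * ha (w' - s)) w e := by
    funext w
    rw [fderiv_integral_normed_mul_comp_sub_apply φ (hha3.of_le (by norm_num)) w e]
  -- `P[ψ, h_a] = ∂ₐ∂ₐ Σ`
  have hP2 : (fun w' => ∫ s, φ.normed volume s * ha (w' - s)) =
      fun w' => fderiv ℝ (fun w => fderiv ℝ Sig w a) w' a := by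
    funext w'
    have h1 : (fun w => fderiv ℝ Sig w a) = fun w => ∫ s, φ.normed volume s * Φa (w - s) := by
      funext w
      rw [hSig, fderiv_integral_normed_mul_comp_sub_apply φ (hΦ5.of_le (by norm_num)) w a]
    rw [h1, fderiv_integral_normed_mul_comp_sub_apply φ (hΦa4.of_le (by norm_num)) w' a]
  rw [hP1, hP2]
  have hS3 : ContDiff ℝ 3 (fun w' => fderiv ℝ (fun w => fderiv ℝ Sig w a) w' a) :=
    (((hSig5.fderiv_right (m := 4) (by norm_num)).clm_apply contDiff_const).fderiv_right
      (m := 3) (by norm_num)).clm_apply contDiff_const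
  rw [← fderiv_laplacian_apply hS3]
  -- `Δ(∂ₐ∂ₐ Σ) = ∂ₐ∂ₐ(ΔΣ) = ∂ₐ∂ₐ σ`
  have hSa4 : ContDiff ℝ 4 (fun w => fderiv ℝ Sig w a) :=
    (hSig5.fderiv_right (m := 4) (by norm_num)).clm_apply contDiff_const
  have hΔ1 : Δ (fun w' => fderiv ℝ (fun w => fderiv ℝ Sig w a) w' a) =
      fun w' => fderiv ℝ (Δ (fun w => fderiv ℝ Sig w a)) w' a := by
    funext w'
    rw [fderiv_laplacian_apply (hSa4.of_le (by norm_num))]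
  have hΔ2 : Δ (fun w => fderiv ℝ Sig w a) = fun w => fderiv ℝ (Δ Sig) w a := by
    funext w
    rw [fderiv_laplacian_apply (hSig5.of_le (by norm_num))]
  rw [hΔ1, hΔ2, hΔSig]
  -- commute `∂ₑ∂ₐ∂ₐ σ = ∂ₐ∂ₐ∂ₑ σ`
  have hl3 : ContDiff ℝ 3 (Δ (newtonReg δ)) := by
    rw [laplacian_newtonReg hδ]
    exact contDiff_newtonFarLaplacian (half_pos_lt hδ).1 (half_pos_lt hδ).2
  exact fderiv3_comm (contDiff_integral_normed_mul_comp_sub φ 3 hl3) (b - x) e a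

/-- The test function `θ(y) = ∂ₑσ(b - y)` of the harmonicity computation: its Laplacian is
`∂ₑ(Δσ)(b - ·)` and its pure second derivatives are `∂ₐ∂ₐ∂ₑσ(b - ·)`. [folklore] -/
theorem laplacian_and_fderiv2_test (hδ : 0 < δ) (b x a e : EuclideanSpace ℝ (Fin 3)) :
    Δ (fun y => fderiv ℝ (fun w => ∫ s, φ.normed volume s * Δ (newtonReg δ) (w - s)) (b - y) e) x =
        fderiv ℝ (Δ (fun w => ∫ s, φ.normed volume s * Δ (newtonReg δ) (w - s))) (b - x) e ∧
      fderiv ℝ (fderiv ℝ (fun y => fderiv ℝ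
          (fun w => ∫ s, φ.normed volume s * Δ (newtonReg δ) (w - s)) (b - y) e)) x a a =
        fderiv ℝ (fun w => fderiv ℝ (fun w' =>
          fderiv ℝ (fun w'' => ∫ s, φ.normed volume s * Δ (newtonReg δ) (w'' - s)) w' e) w a)
            (b - x) a := by
  set σ : EuclideanSpace ℝ (Fin 3) → ℝ := fun w => ∫ s, φ.normed volume s * Δ (newtonReg δ) (w - s)
    with hσ
  have hl3 : ContDiff ℝ 3 (Δ (newtonReg δ)) := by
    rw [laplacian_newtonReg hδ]
    exact contDiff_newtonFarLaplacian (half_pos_lt hδ).1 (half_pos_lt hδ).2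
  have hσ3 : ContDiff ℝ 3 σ := contDiff_integral_normed_mul_comp_sub φ 3 hl3
  set g : EuclideanSpace ℝ (Fin 3) → ℝ := fun w => fderiv ℝ σ w e with hg
  have hg2 : ContDiff ℝ 2 g := (hσ3.fderiv_right (m := 2) (by norm_num)).clm_apply contDiff_const
  constructor
  · rw [show (fun y => fderiv ℝ σ (b - y) e) = fun y => g (b - y) from rfl,
      laplacian_comp_const_sub g b x, hg, ← fderiv_laplacian_apply hσ3]
  · rw [show (fun y => fderiv ℝ σ (b - y) e) = fun y => g (b - y) from rfl,
      fderiv2_comp_const_sub g b x]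
    have hdg : DifferentiableAt ℝ (fderiv ℝ g) (b - x) :=
      ((hg2.fderiv_right (m := 1) (by norm_num)).differentiable (by norm_num)) _
    rw [← FluidPDE.fderiv_apply_const_apply hdg a a]

end MollifiedProfile

/-! ## Harmonicity of the mollified functional -/

section Harmonicity

variable {T ν : ℝ} {v₀ : EuclideanSpace ℝ (Fin 3) → EuclideanSpace ℝ (Fin 3)}
  {v : ℝ → EuclideanSpace ℝ (Fin 3) → EuclideanSpace ℝ (Fin 3)}
  {π : ℝ → EuclideanSpace ℝ (Fin 3) → ℝ} {δ : ℝ} {η : ℝ → ℝ}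

/-- A continuous bilinear-form-valued weight vanishing off a compact subset `K` of the slab,
paired with `v ⊗ v`, is integrable on the slab (`|v|² ∈ L¹_loc`). [folklore] -/
theorem IsLocalLeraySolutionOn.integrable_evalDiag_weight_of_support
    (hv : IsLocalLeraySolutionOn T ν v₀ v π) {K : Set (ℝ × EuclideanSpace ℝ (Fin 3))}
    (hK : IsCompact K) (hKQ : K ⊆ Ioo (0 : ℝ) T ×ˢ (univ : Set (EuclideanSpace ℝ (Fin 3))))
    {Θ : ℝ × EuclideanSpace ℝ (Fin 3) → EuclideanSpace ℝ (Fin 3) →L[ℝ] EuclideanSpace ℝ (Fin 3) →L[ℝ] ℝ}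
    (hΘ : Continuous Θ) (h0 : ∀ z, z ∉ K → Θ z = 0) :
    Integrable (fun z => evalDiag (v z.1 z.2) (Θ z))
      (volume.restrict (Ioo (0 : ℝ) T ×ˢ (univ : Set (EuclideanSpace ℝ (Fin 3))))) := by
  obtain ⟨M, hM⟩ := hΘ.bounded_above_of_compact_support (HasCompactSupport.intro hK h0)
  have hv2K : IntegrableOn (fun z => ‖uncurry v z‖ ^ 2) K volume :=
    hv.distributional.2.1.integrableOn_compact_subset hKQ hK
  have hdom : Integrable (fun z => M * K.indicator (fun z => ‖uncurry v z‖ ^ 2) z)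
      (volume.restrict (Ioo (0 : ℝ) T ×ˢ (univ : Set (EuclideanSpace ℝ (Fin 3))))) :=
    ((hv2K.integrable_indicator hK.measurableSet).mono_measure Measure.restrict_le_self).const_mul _
  refine Integrable.mono' hdom (aestronglyMeasurable_evalDiag_apply' hv.aestronglyMeasurable
    hΘ.aestronglyMeasurable) (Eventually.of_forall fun z => ?_)
  by_cases hz : z ∈ K
  · rw [indicator_of_mem hz]
    simp only [uncurry]
    calc ‖evalDiag (v z.1 z.2) (Θ z)‖ ≤ ‖evalDiag (v z.1 z.2)‖ * ‖Θ z‖ :=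
          ContinuousLinearMap.le_opNorm _ _
      _ ≤ ‖v z.1 z.2‖ ^ 2 * M := mul_le_mul (norm_evalDiag_le _) (hM z) (norm_nonneg _) (by positivity)
      _ = M * ‖v z.1 z.2‖ ^ 2 := by ring
  · rw [h0 z hz, indicator_of_notMem hz]
    simp

/-- The test function of the harmonicity computation, `θ(y) = ∂ₑσ(b - y)` with `σ = P[ψ, λ_δ]`,
is a test function on `ℝ³`. [folklore] -/
theorem isTestFunctionOn_fderiv_mollifiedProfile (φ : ContDiffBump (0 : EuclideanSpace ℝ (Fin 3)))
    (hδ : 0 < δ) (b e : EuclideanSpace ℝ (Fin 3)) :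
    FunctionSpaces.IsTestFunctionOn (⊤ : TopologicalSpace.Opens (EuclideanSpace ℝ (Fin 3)))
      (fun y => fderiv ℝ (fun w => ∫ s, φ.normed volume s * Δ (newtonReg δ) (w - s)) (b - y) e) := by
  set σ : EuclideanSpace ℝ (Fin 3) → ℝ := fun w => ∫ s, φ.normed volume s * Δ (newtonReg δ) (w - s)
    with hσ
  have hσs : ∀ n : ℕ, ContDiff ℝ n σ := fun n =>
    contDiff_integral_normed_mul_comp_sub φ n (contDiff_laplacian_newtonReg hδ (n := n))
  have hσ0 : ∀ w : EuclideanSpace ℝ (Fin 3), δ + φ.rOut < ‖w‖ → σ w = 0 := fun w hw =>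
    integral_normed_mul_comp_sub_eq_zero φ (fun z hz => laplacian_newtonReg_eq_zero hδ hz) hw
  have hfd0 : ∀ w : EuclideanSpace ℝ (Fin 3), δ + φ.rOut < ‖w‖ → fderiv ℝ σ w = 0 := by
    intro w hw
    have hopen : IsOpen {w : EuclideanSpace ℝ (Fin 3) | δ + φ.rOut < ‖w‖} :=
      isOpen_lt continuous_const continuous_norm
    have hev : σ =ᶠ[𝓝 w] fun _ => 0 := by
      filter_upwards [hopen.mem_nhds hw] with w' hw'
      exact hσ0 w' hw'
    rw [hev.fderiv_eq]
    exact fderiv_const_apply 0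
  refine ⟨?_, ?_, by simp⟩
  · refine contDiff_infty.2 fun n => ?_
    exact (((hσs (n + 1)).fderiv_right (m := n) (by push_cast; exact le_rfl)).clm_apply
      contDiff_const).comp (contDiff_const.sub contDiff_id)
  · refine HasCompactSupport.intro (isCompact_closedBall b (δ + φ.rOut)) fun y hy => ?_
    rw [mem_closedBall, dist_eq_norm, not_le, ← norm_sub_rev] at hy
    simp only [hfd0 _ hy, _root_.zero_apply]

namespace IsLocalLeraySolutionOn

/-- **The mollifications of the functional are harmonic.** For a local Leray solution on the
slab, `η ∈ C_c^∞((0,T))`, a direction `e`, `δ > 0` and a Mathlib bump `φ`, the mollification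
`ψ ⋆ F` (`ψ = φ.normed`) of the functional
`F(c) = ∫∫ η [π ∂ₑλ_δ(c - x) + D³Φ_δ(c - x)(e)(v,v)]` has vanishing Laplacian at every point:
after `Δ(ψ ⋆ F)(b) = ∫ Δψ(s) F(b - s) ds` and Fubini, the Laplacian is moved onto the profile
(`integral_laplacian_normed_mul_fderiv_laplacian_newtonReg`,
`integral_laplacian_normed_mul_evalDiag_fderiv3_newtonReg`), which turns the integrand into
`η(t) [π(t,x) Δθ(x) + D²θ(x)(v,v)]` for the test function `θ = ∂ₑσ(b - ·)`, and the pressure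
Poisson equation on a.e. slice concludes. [cite: FernandezdalgoLemarierieusset2021, Thm. 1 and §5 (Ũ = S - ∇p_φ is harmonic)] -/
theorem laplacian_normed_convolution_pgFunctional_eq_zero (hv : IsLocalLeraySolutionOn T ν v₀ v π)
    (hδ : 0 < δ) (hη : ContDiff ℝ (⊤ : ℕ∞) η) (hηc : HasCompactSupport η) (hηT : tsupport η ⊆ Ioo 0 T)
    (e : EuclideanSpace ℝ (Fin 3)) (φ : ContDiffBump (0 : EuclideanSpace ℝ (Fin 3)))
    (b : EuclideanSpace ℝ (Fin 3)) :
    Δ (φ.normed volume ⋆[ContinuousLinearMap.lsmul ℝ ℝ, volume] fun c : EuclideanSpace ℝ (Fin 3) =>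
      ∫ z in Ioo (0 : ℝ) T ×ˢ (univ : Set (EuclideanSpace ℝ (Fin 3))), η z.1 *
        (π z.1 z.2 * fderiv ℝ (Δ (newtonReg δ)) (c - z.2) e +
          evalDiag (v z.1 z.2) (fderiv ℝ (fderiv ℝ (fderiv ℝ (newtonReg δ))) (c - z.2) e))) b = 0 := by
  have hηc1 : Continuous η := hη.continuous
  obtain ⟨Mη, hMη⟩ := hηc1.bounded_above_of_compact_support hηc
  have hMη0 : 0 ≤ Mη := (norm_nonneg _).trans (hMη 0)
  obtain ⟨M₀, M₁, M₂, -, hM₁0, -, -, hM₁, -⟩ := exists_bounds_laplacian_newtonReg hδ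
  obtain ⟨C, hC0, hC⟩ := exists_norm_fderiv3_newtonReg_le_inv hδ
  set ψ : EuclideanSpace ℝ (Fin 3) → ℝ := φ.normed volume with hψ
  set lam : EuclideanSpace ℝ (Fin 3) → ℝ := Δ (newtonReg δ) with hlam
  set K3 : EuclideanSpace ℝ (Fin 3) → EuclideanSpace ℝ (Fin 3) →L[ℝ]
      EuclideanSpace ℝ (Fin 3) →L[ℝ] EuclideanSpace ℝ (Fin 3) →L[ℝ] ℝ :=
    fderiv ℝ (fderiv ℝ (fderiv ℝ (newtonReg δ))) with hK3
  set μQ : Measure (ℝ × EuclideanSpace ℝ (Fin 3)) :=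
    volume.restrict (Ioo (0 : ℝ) T ×ˢ (univ : Set (EuclideanSpace ℝ (Fin 3)))) with hμQ
  set I : ℝ × EuclideanSpace ℝ (Fin 3) → EuclideanSpace ℝ (Fin 3) → ℝ := fun z c =>
    η z.1 * (π z.1 z.2 * fderiv ℝ lam (c - z.2) e + evalDiag (v z.1 z.2) (K3 (c - z.2) e)) with hI
  set F : EuclideanSpace ℝ (Fin 3) → ℝ := fun c => ∫ z, I z c ∂μQ with hF
  have hFc : Continuous F := hv.continuous_pgFunctional hδ hηc1 hηc hηT e
  -- Step 1: the Laplacian falls on the bump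
  rw [laplacian_convolution_lsmul φ.contDiff_normed φ.hasCompactSupport_normed hFc.locallyIntegrable b,
    convolution_lsmul_apply]
  -- Step 2: Fubini in `(s, z)`
  obtain ⟨Mψ, hMψ⟩ := (FluidPDE.continuous_laplacian (φ.contDiff_normed (μ := volume) (n := 2))).bounded_above_of_compact_support
    ((φ.hasCompactSupport_normed (μ := volume)).mono' fun z hz => by
      contrapose! hz
      simp [FluidPDE.laplacian_eq_zero_of_notMem_tsupport hz])
  have hMψ0 : 0 ≤ Mψ := (norm_nonneg _).trans (hMψ 0)
  have hΔψ0 : ∀ s : EuclideanSpace ℝ (Fin 3), φ.rOut < ‖s‖ → Δ ψ s = 0 := by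
    intro s hs
    refine FluidPDE.laplacian_eq_zero_of_notMem_tsupport ?_
    rw [hψ, φ.tsupport_normed_eq, mem_closedBall_zero_iff, not_le]
    exact hs
  set ρ : ℝ := φ.rOut with hρ
  have hρ0 : 0 < ρ := φ.rOut_pos
  -- the compact set carrying the pressure term
  set Kb : Set (ℝ × EuclideanSpace ℝ (Fin 3)) := tsupport η ×ˢ closedBall b (δ + ρ) with hKb
  have hKbc : IsCompact Kb := hηc.isCompact.prod (isCompact_closedBall _ _)
  have hKbQ : Kb ⊆ Ioo (0 : ℝ) T ×ˢ (univ : Set (EuclideanSpace ℝ (Fin 3))) :=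
    prod_mono hηT (subset_univ _)
  have hπKb : IntegrableOn (uncurry π) Kb volume :=
    hv.distributional.2.2.1.integrableOn_compact_subset hKbQ hKbc
  have hballs : ∀ s ∈ closedBall (0 : EuclideanSpace ℝ (Fin 3)) ρ,
      closedBall (b - s) δ ⊆ closedBall b (δ + ρ) := by
    intro s hs y hy
    rw [mem_closedBall_zero_iff] at hs
    rw [mem_closedBall, dist_eq_norm] at hy ⊢
    calc ‖y - b‖ = ‖(y - (b - s)) - s‖ := by abel_nf
      _ ≤ ‖y - (b - s)‖ + ‖s‖ := norm_sub_le _ _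
      _ ≤ δ + ρ := add_le_add hy hs
  -- the dominating product function
  set gz : ℝ × EuclideanSpace ℝ (Fin 3) → ℝ := fun z =>
    Mψ * (Mη * (M₁ * ‖e‖) * ‖Kb.indicator (uncurry π) z‖ +
      Mη * (C * ‖e‖) * (1 + ρ) ^ 4 * (((1 + ‖z.2 - b‖) ^ 4)⁻¹ * ‖v z.1 z.2‖ ^ 2)) with hgz
  have hgzi : Integrable gz μQ := by
    refine Integrable.const_mul (Integrable.add (Integrable.const_mul ?_ _)
      ((hv.integrable_slab_weight_mul_norm_sq b).const_mul _)) _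
    exact ((hπKb.integrable_indicator hKbc.measurableSet).mono_measure Measure.restrict_le_self).norm
  have hfs : Integrable (fun s : EuclideanSpace ℝ (Fin 3) => (closedBall (0 : EuclideanSpace ℝ (Fin 3)) ρ).indicator
      (fun _ => (1 : ℝ)) s) volume := by
    refine IntegrableOn.integrable_indicator ?_ measurableSet_closedBall
    exact (integrableOn_const_iff (by simp)).2 (Or.inr measure_closedBall_lt_top)
  have hdom : Integrable (fun p : EuclideanSpace ℝ (Fin 3) × (ℝ × EuclideanSpace ℝ (Fin 3)) =>
      (closedBall (0 : EuclideanSpace ℝ (Fin 3)) ρ).indicator (fun _ => (1 : ℝ)) p.1 * gz p.2)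
      ((volume : Measure (EuclideanSpace ℝ (Fin 3))).prod μQ) := hfs.mul_prod hgzi
  -- measurability of the integrand on the product
  have hπ2 : AEStronglyMeasurable (fun p : EuclideanSpace ℝ (Fin 3) × (ℝ × EuclideanSpace ℝ (Fin 3)) =>
      π p.2.1 p.2.2) ((volume : Measure (EuclideanSpace ℝ (Fin 3))).prod μQ) :=
    hv.aestronglyMeasurable_pressure.comp_quasiMeasurePreserving Measure.quasiMeasurePreserving_snd
  have hv2 : AEStronglyMeasurable (fun p : EuclideanSpace ℝ (Fin 3) × (ℝ × EuclideanSpace ℝ (Fin 3)) =>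
      v p.2.1 p.2.2) ((volume : Measure (EuclideanSpace ℝ (Fin 3))).prod μQ) :=
    hv.aestronglyMeasurable.comp_quasiMeasurePreserving Measure.quasiMeasurePreserving_snd
  have hl1 : ContDiff ℝ 1 lam := contDiff_laplacian_newtonReg hδ (n := 1)
  have hmeas : AEStronglyMeasurable (uncurry fun (s : EuclideanSpace ℝ (Fin 3))
      (z : ℝ × EuclideanSpace ℝ (Fin 3)) => Δ ψ s * I z (b - s))
      ((volume : Measure (EuclideanSpace ℝ (Fin 3))).prod μQ) := by
    have hc1 : Continuous fun p : EuclideanSpace ℝ (Fin 3) × (ℝ × EuclideanSpace ℝ (Fin 3)) =>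
        Δ ψ p.1 := (FluidPDE.continuous_laplacian (φ.contDiff_normed (μ := volume) (n := 2))).comp continuous_fst
    have hc2 : Continuous fun p : EuclideanSpace ℝ (Fin 3) × (ℝ × EuclideanSpace ℝ (Fin 3)) =>
        η p.2.1 := hηc1.comp (continuous_fst.comp continuous_snd)
    have hc3 : Continuous fun p : EuclideanSpace ℝ (Fin 3) × (ℝ × EuclideanSpace ℝ (Fin 3)) =>
        fderiv ℝ lam (b - p.1 - p.2.2) e :=
      ((hl1.continuous_fderiv one_ne_zero).comp ((continuous_const.sub continuous_fst).sub
        (continuous_snd.comp continuous_snd))).clm_apply continuous_const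
    have hc4 : Continuous fun p : EuclideanSpace ℝ (Fin 3) × (ℝ × EuclideanSpace ℝ (Fin 3)) =>
        K3 (b - p.1 - p.2.2) e :=
      ((continuous_fderiv3_newtonReg δ).comp ((continuous_const.sub continuous_fst).sub
        (continuous_snd.comp continuous_snd))).clm_apply continuous_const
    have h5 : AEStronglyMeasurable (fun p : EuclideanSpace ℝ (Fin 3) × (ℝ × EuclideanSpace ℝ (Fin 3)) =>
        evalDiag (v p.2.1 p.2.2) (K3 (b - p.1 - p.2.2) e)) ((volume : Measure (EuclideanSpace ℝ (Fin 3))).prod μQ) :=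
      aestronglyMeasurable_evalDiag_apply' hv2 hc4.aestronglyMeasurable
    exact hc1.aestronglyMeasurable.mul (hc2.aestronglyMeasurable.mul
      ((hπ2.mul hc3.aestronglyMeasurable).add h5))
  have hprodInt : Integrable (uncurry fun (s : EuclideanSpace ℝ (Fin 3))
      (z : ℝ × EuclideanSpace ℝ (Fin 3)) => Δ ψ s * I z (b - s))
      ((volume : Measure (EuclideanSpace ℝ (Fin 3))).prod μQ) := by
    refine Integrable.mono' hdom hmeas (Eventually.of_forall fun p => ?_)
    rcases p with ⟨s, z⟩
    simp only [uncurry]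
    by_cases hs : s ∈ closedBall (0 : EuclideanSpace ℝ (Fin 3)) ρ
    · rw [indicator_of_mem hs, one_mul, norm_mul, hgz]
      dsimp only
      refine mul_le_mul (hMψ s) ?_ (norm_nonneg _) hMψ0
      rw [hI]
      dsimp only
      rw [mul_add]
      refine (norm_add_le _ _).trans (add_le_add ?_ ?_)
      · -- pressure part
        by_cases hz : z ∈ Kb
        · rw [indicator_of_mem hz, norm_mul, norm_mul]
          simp only [uncurry]
          calc ‖η z.1‖ * (‖π z.1 z.2‖ * ‖fderiv ℝ lam (b - s - z.2) e‖)
              ≤ Mη * (‖π z.1 z.2‖ * (M₁ * ‖e‖)) := by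
                refine mul_le_mul (hMη _) (mul_le_mul_of_nonneg_left ?_ (norm_nonneg _))
                  (by positivity) hMη0
                exact (ContinuousLinearMap.le_opNorm _ _).trans
                  (mul_le_mul_of_nonneg_right (hM₁ _) (norm_nonneg _))
            _ = Mη * (M₁ * ‖e‖) * ‖π z.1 z.2‖ := by ring
        · have h0 := pressure_term_eq_zero_of_notMem hδ (hballs s hs) π e hz
          rw [hlam, h0, norm_zero]
          positivity
      · -- velocity part
        have hsn : ‖s‖ ≤ ρ := mem_closedBall_zero_iff.1 hs
        have hcmp : ((1 + ‖b - s - z.2‖) ^ 4)⁻¹ ≤ (1 + ρ) ^ 4 * ((1 + ‖z.2 - b‖) ^ 4)⁻¹ := by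
          have h1 : ((1 + ‖b - s - z.2‖) ^ 4)⁻¹ ≤ (1 + ‖s‖) ^ 4 * ((1 + ‖z.2 - b‖) ^ 4)⁻¹ := by
            refine inv_one_add_pow_le_mul (norm_nonneg _) (norm_nonneg _) ?_
            have : ‖z.2 - b‖ ≤ ‖b - s - z.2‖ + ‖s‖ := by
              calc ‖z.2 - b‖ = ‖(b - s - z.2) + s‖ := by
                    rw [← norm_neg (z.2 - b)]; congr 1; abel
                _ ≤ ‖b - s - z.2‖ + ‖s‖ := norm_add_le _ _
            nlinarith [norm_nonneg (b - s - z.2), norm_nonneg s]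
          refine h1.trans (mul_le_mul_of_nonneg_right ?_ (by positivity))
          exact pow_le_pow_left₀ (by positivity) (by linarith) 4
        rw [norm_mul]
        calc ‖η z.1‖ * ‖evalDiag (v z.1 z.2) (K3 (b - s - z.2) e)‖
            ≤ Mη * (‖evalDiag (v z.1 z.2)‖ * ‖K3 (b - s - z.2) e‖) :=
              mul_le_mul (hMη _) (ContinuousLinearMap.le_opNorm _ _) (norm_nonneg _) hMη0
          _ ≤ Mη * (‖v z.1 z.2‖ ^ 2 * (C * ((1 + ρ) ^ 4 * ((1 + ‖z.2 - b‖) ^ 4)⁻¹) * ‖e‖)) := by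
              refine mul_le_mul_of_nonneg_left (mul_le_mul (norm_evalDiag_le _) ?_ (norm_nonneg _)
                (by positivity)) hMη0
              refine (ContinuousLinearMap.le_opNorm _ _).trans (mul_le_mul_of_nonneg_right ?_ (norm_nonneg _))
              exact (hC _).trans (mul_le_mul_of_nonneg_left hcmp hC0)
          _ = Mη * (C * ‖e‖) * (1 + ρ) ^ 4 * (((1 + ‖z.2 - b‖) ^ 4)⁻¹ * ‖v z.1 z.2‖ ^ 2) := by ring
    · have hs' : ρ < ‖s‖ := by rwa [mem_closedBall_zero_iff, not_le] at hs
      rw [hΔψ0 s hs', zero_mul, norm_zero, indicator_of_notMem hs, zero_mul]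
  have hswap : ∫ s, Δ ψ s * F (b - s) = ∫ z, (∫ s, Δ ψ s * I z (b - s)) ∂μQ := by
    have h1 : ∀ s, Δ ψ s * F (b - s) = ∫ z, Δ ψ s * I z (b - s) ∂μQ := fun s => by
      rw [hF]
      exact (integral_const_mul _ _).symm
    simp_rw [h1]
    exact integral_integral_swap hprodInt
  rw [hswap]
  -- Step 3: the inner integral, pointwise in `z`
  set σ : EuclideanSpace ℝ (Fin 3) → ℝ := fun w => ∫ s, ψ s * lam (w - s) with hσ
  set θ : EuclideanSpace ℝ (Fin 3) → ℝ := fun y => fderiv ℝ σ (b - y) e with hθ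
  have hθtest : FunctionSpaces.IsTestFunctionOn (⊤ : TopologicalSpace.Opens (EuclideanSpace ℝ (Fin 3))) θ :=
    isTestFunctionOn_fderiv_mollifiedProfile φ hδ b e
  have hinner : ∀ z : ℝ × EuclideanSpace ℝ (Fin 3), ∫ s, Δ ψ s * I z (b - s) =
      η z.1 * (π z.1 z.2 * Δ θ z.2 + fderiv ℝ (fderiv ℝ θ) z.2 (v z.1 z.2) (v z.1 z.2)) := by
    intro z
    obtain ⟨hΔθ, hD2θ⟩ := laplacian_and_fderiv2_test φ hδ b z.2 (v z.1 z.2) e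
    have hA : ∫ s, Δ ψ s * fderiv ℝ lam (b - s - z.2) e = Δ θ z.2 := by
      rw [hθ, hΔθ]
      exact integral_laplacian_normed_mul_fderiv_laplacian_newtonReg φ hδ b z.2 e
    have hB : ∫ s, Δ ψ s * evalDiag (v z.1 z.2) (K3 (b - s - z.2) e) =
        fderiv ℝ (fderiv ℝ θ) z.2 (v z.1 z.2) (v z.1 z.2) := by
      rw [hθ, hD2θ]
      exact integral_laplacian_normed_mul_evalDiag_fderiv3_newtonReg φ hδ b z.2 e (v z.1 z.2)
    -- integrability in `s` of the two pieces (continuous, compactly supported in `s`)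
    have hΔψc : Continuous (Δ ψ) := FluidPDE.continuous_laplacian (φ.contDiff_normed (μ := volume) (n := 2))
    have hΔψs : HasCompactSupport (Δ ψ) := (φ.hasCompactSupport_normed (μ := volume)).mono' fun z hz => by
      contrapose! hz
      rw [Function.mem_support, not_not]
      exact FluidPDE.laplacian_eq_zero_of_notMem_tsupport hz
    have hiA : Integrable fun s => Δ ψ s * fderiv ℝ lam (b - s - z.2) e :=
      (hΔψc.mul (((hl1.continuous_fderiv one_ne_zero).comp ((continuous_const.sub continuous_id).sub
        continuous_const)).clm_apply continuous_const)).integrable_of_hasCompactSupport hΔψs.mul_right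
    have hiB : Integrable fun s => Δ ψ s * evalDiag (v z.1 z.2) (K3 (b - s - z.2) e) :=
      (hΔψc.mul ((evalDiag (v z.1 z.2)).continuous.comp (((continuous_fderiv3_newtonReg δ).comp
        ((continuous_const.sub continuous_id).sub continuous_const)).clm_apply
          continuous_const))).integrable_of_hasCompactSupport hΔψs.mul_right
    have hsplit : ∀ s, Δ ψ s * I z (b - s) = η z.1 * π z.1 z.2 * (Δ ψ s * fderiv ℝ lam (b - s - z.2) e) +
        η z.1 * (Δ ψ s * evalDiag (v z.1 z.2) (K3 (b - s - z.2) e)) := fun s => by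
      rw [hI]
      ring
    simp_rw [hsplit]
    rw [integral_add (hiA.const_mul _) (hiB.const_mul _), integral_const_mul, integral_const_mul,
      hA, hB]
    ring
  simp_rw [hinner]
  -- Step 4: slice and apply the pressure Poisson equation at a.e. time
  set Kθ : Set (ℝ × EuclideanSpace ℝ (Fin 3)) := tsupport η ×ˢ tsupport θ with hKθ
  have hKθc : IsCompact Kθ := hηc.isCompact.prod hθtest.hasCompactSupport
  have hKθQ : Kθ ⊆ Ioo (0 : ℝ) T ×ˢ (univ : Set (EuclideanSpace ℝ (Fin 3))) :=
    prod_mono hηT (subset_univ _)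
  have hθc2 : ContDiff ℝ 2 θ := contDiff_infty.1 hθtest.contDiff 2
  have hΔθc : Continuous (Δ θ) := FluidPDE.continuous_laplacian hθc2
  have hD2θc : Continuous (fderiv ℝ (fderiv ℝ θ)) :=
    (hθc2.fderiv_right (m := 1) le_rfl).continuous_fderiv one_ne_zero
  have hI1 : Integrable (fun z : ℝ × EuclideanSpace ℝ (Fin 3) => η z.1 * Δ θ z.2 * π z.1 z.2) μQ := by
    refine integrable_weight_mul_of_integrableOn hKθc ((hηc1.comp continuous_fst).mul
      (hΔθc.comp continuous_snd)) (fun z hz => ?_)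
      (hv.distributional.2.2.1.integrableOn_compact_subset hKθQ hKθc)
    rw [hKθ, Set.mem_prod, not_and_or] at hz
    rcases hz with h | h
    · rw [image_eq_zero_of_notMem_tsupport h, zero_mul]
    · rw [FluidPDE.laplacian_eq_zero_of_notMem_tsupport h, mul_zero]
  have hI2 : Integrable (fun z : ℝ × EuclideanSpace ℝ (Fin 3) =>
      evalDiag (v z.1 z.2) (η z.1 • fderiv ℝ (fderiv ℝ θ) z.2)) μQ := by
    refine hv.integrable_evalDiag_weight_of_support hKθc hKθQ
      ((hηc1.comp continuous_fst).smul (hD2θc.comp continuous_snd)) (fun z hz => ?_)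
    rw [hKθ, Set.mem_prod, not_and_or] at hz
    rcases hz with h | h
    · rw [image_eq_zero_of_notMem_tsupport h, zero_smul]
    · rw [fderiv_fderiv_eq_zero_of_notMem_tsupport h, smul_zero]
  have hIsum : Integrable (fun z : ℝ × EuclideanSpace ℝ (Fin 3) =>
      η z.1 * (π z.1 z.2 * Δ θ z.2 + fderiv ℝ (fderiv ℝ θ) z.2 (v z.1 z.2) (v z.1 z.2))) μQ := by
    refine (hI1.add hI2).congr (Eventually.of_forall fun z => ?_)
    simp only [Pi.add_apply, evalDiag_apply, _root_.smul_apply, smul_eq_mul]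
    ring
  rw [hμQ, volume_restrict_slab_eq_prod] at hIsum
  rw [hμQ, volume_restrict_slab_eq_prod, integral_prod _ hIsum]
  -- a.e. in time the inner integral vanishes
  have hae : ∀ᵐ t ∂(volume.restrict (Ioo (0 : ℝ) T)),
      ∫ x, η t * (π t x * Δ θ x + fderiv ℝ (fderiv ℝ θ) x (v t x) (v t x)) = 0 := by
    filter_upwards [hv.ae_slice_pressure_poisson, hv.ae_locallyIntegrable_pressure_slice,
      hv.ae_locallyIntegrable_norm_sq_slice, hv.ae_aestronglyMeasurable_slice'] with t hP hπt hv2t hmt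
    have hid := hP θ hθtest
    have hΔθs : HasCompactSupport (Δ θ) := hθtest.hasCompactSupport.mono' fun z hz => by
      contrapose! hz
      simp [FluidPDE.laplacian_eq_zero_of_notMem_tsupport hz]
    have hD2θs : HasCompactSupport (fderiv ℝ (fderiv ℝ θ)) :=
      (hθtest.hasCompactSupport.fderiv (𝕜 := ℝ)).fderiv (𝕜 := ℝ)
    have hi1 : Integrable (fun x => π t x * Δ θ x) volume := by
      have h := hπt.integrable_smul_right_of_hasCompactSupport hΔθc hΔθs
      simpa only [smul_eq_mul] using h
    have hi2 : Integrable (fun x => fderiv ℝ (fderiv ℝ θ) x (v t x) (v t x)) volume := by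
      obtain ⟨M, hM⟩ := hD2θc.bounded_above_of_compact_support hD2θs
      have hdom : Integrable (fun x => M * (tsupport θ).indicator (fun x => ‖v t x‖ ^ 2) x) volume :=
        ((hv2t.integrableOn_isCompact hθtest.hasCompactSupport).integrable_indicator
          (hθtest.hasCompactSupport.measurableSet)).const_mul _
      refine Integrable.mono' hdom ?_ (Eventually.of_forall fun x => ?_)
      · have := aestronglyMeasurable_evalDiag_apply hmt hD2θc.aestronglyMeasurable
        simpa only [evalDiag_apply] using this
      · by_cases hx : x ∈ tsupport θ
        · rw [indicator_of_mem hx]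
          calc ‖fderiv ℝ (fderiv ℝ θ) x (v t x) (v t x)‖
              ≤ ‖fderiv ℝ (fderiv ℝ θ) x (v t x)‖ * ‖v t x‖ := ContinuousLinearMap.le_opNorm _ _
            _ ≤ ‖fderiv ℝ (fderiv ℝ θ) x‖ * ‖v t x‖ * ‖v t x‖ :=
                mul_le_mul_of_nonneg_right (ContinuousLinearMap.le_opNorm _ _) (norm_nonneg _)
            _ ≤ M * ‖v t x‖ * ‖v t x‖ := by gcongr; exact hM x
            _ = M * ‖v t x‖ ^ 2 := by ring
        · rw [fderiv_fderiv_eq_zero_of_notMem_tsupport hx, indicator_of_notMem hx]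
          simp
    calc ∫ x, η t * (π t x * Δ θ x + fderiv ℝ (fderiv ℝ θ) x (v t x) (v t x))
        = η t * ((∫ x, π t x * Δ θ x) + ∫ x, fderiv ℝ (fderiv ℝ θ) x (v t x) (v t x)) := by
          rw [integral_const_mul, integral_add hi1 hi2]
      _ = 0 := by rw [hid]; ring
  rw [integral_congr_ae hae, integral_zero]

end IsLocalLeraySolutionOn

end Harmonicity

/-! ## Liouville: the functional vanishes identically -/

section Liouville

variable {T ν : ℝ} {v₀ : EuclideanSpace ℝ (Fin 3) → EuclideanSpace ℝ (Fin 3)}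
  {v : ℝ → EuclideanSpace ℝ (Fin 3) → EuclideanSpace ℝ (Fin 3)}
  {π : ℝ → EuclideanSpace ℝ (Fin 3) → ℝ} {δ : ℝ} {η : ℝ → ℝ}

/-- Mollification by a bump preserves decay at infinity: if `F` is continuous and `F → 0` along
`cocompact`, then so does `φ.normed ⋆ F`. [folklore] -/
theorem normed_convolution_tendsto_cocompact (φ : ContDiffBump (0 : EuclideanSpace ℝ (Fin 3)))
    {F : EuclideanSpace ℝ (Fin 3) → ℝ}
    (hF0 : Tendsto F (cocompact (EuclideanSpace ℝ (Fin 3))) (𝓝 0)) :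
    Tendsto (φ.normed volume ⋆[ContinuousLinearMap.lsmul ℝ ℝ, volume] F)
      (cocompact (EuclideanSpace ℝ (Fin 3))) (𝓝 0) := by
  refine Metric.tendsto_nhds.2 fun ε hε => ?_
  have hε2 : 0 < ε / 2 := half_pos hε
  -- `‖F y‖ ≤ ε/2` off a closed ball
  have hev : ∀ᶠ y in cocompact (EuclideanSpace ℝ (Fin 3)), ‖F y‖ ≤ ε / 2 := by
    have := hF0.eventually (Metric.closedBall_mem_nhds (0 : ℝ) hε2)
    filter_upwards [this] with y hy
    rwa [dist_zero_right] at hy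
  rw [← Metric.cobounded_eq_cocompact] at hev
  obtain ⟨R, -, hR⟩ := (Metric.hasBasis_cobounded_compl_closedBall (0 : EuclideanSpace ℝ (Fin 3))).eventually_iff.1 hev
  have hmem : (closedBall (0 : EuclideanSpace ℝ (Fin 3)) (R + φ.rOut))ᶜ ∈
      cocompact (EuclideanSpace ℝ (Fin 3)) := (isCompact_closedBall _ _).compl_mem_cocompact
  filter_upwards [hmem] with x hx
  rw [mem_compl_iff, mem_closedBall_zero_iff, not_le] at hx
  rw [dist_zero_right, convolution_lsmul_apply]
  have hbound : ∀ s, ‖φ.normed volume s * F (x - s)‖ ≤ φ.normed volume s * (ε / 2) := by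
    intro s
    rw [norm_mul, Real.norm_eq_abs, abs_of_nonneg (φ.nonneg_normed s)]
    by_cases hs : φ.normed volume s = 0
    · rw [hs, zero_mul, zero_mul]
    · refine mul_le_mul_of_nonneg_left (hR ?_) (φ.nonneg_normed s)
      have hs' : s ∈ Function.support (φ.normed volume) := hs
      rw [φ.support_normed_eq, mem_ball_zero_iff] at hs'
      rw [mem_compl_iff, mem_closedBall_zero_iff, not_le]
      have := norm_sub_norm_le x s
      linarith
  calc ‖∫ s, φ.normed volume s * F (x - s)‖ ≤ ∫ s, φ.normed volume s * (ε / 2) :=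
        norm_integral_le_of_norm_le (φ.integrable_normed.mul_const _) (Eventually.of_forall hbound)
    _ = ε / 2 := by rw [integral_mul_const, φ.integral_normed, one_mul]
    _ < ε := half_lt_self hε

namespace IsLocalLeraySolutionOn

/-- **Liouville: the mollified pressure-gradient functional vanishes identically.** For a
local Leray solution on the slab `(0,T) × ℝ³`, every `η ∈ C_c^∞((0,T))`, direction `e`, `δ > 0`
and centre `c`,
`∫∫ η(t) [π(t,x) ∂ₑλ_δ(c - x) + D³Φ_δ(c - x)(e)(v(t,x), v(t,x))] dx dt = 0`:
each mollification `ψ ⋆ F` of the (continuous) functional `F` is harmonic on `ℝ³`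
(`laplacian_normed_convolution_pgFunctional_eq_zero`) and tends to `0` at infinity
(`tendsto_pgFunctional_cocompact`), hence vanishes (`harmonic_eq_zero_of_tendsto_cocompact`),
and `F = lim ψₙ ⋆ F`. [cite: FernandezdalgoLemarierieusset2021, Thm. 1 and §5 (the harmonic correction vanishes)] [cite: KangMiuraTsai2020, §8 proof of Lemma 3.4 (Liouville step)] -/
theorem pgFunctional_eq_zero (hv : IsLocalLeraySolutionOn T ν v₀ v π) (hδ : 0 < δ)
    (hη : ContDiff ℝ (⊤ : ℕ∞) η) (hηc : HasCompactSupport η) (hηT : tsupport η ⊆ Ioo 0 T)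
    (e c : EuclideanSpace ℝ (Fin 3)) :
    ∫ z in Ioo (0 : ℝ) T ×ˢ (univ : Set (EuclideanSpace ℝ (Fin 3))), η z.1 *
        (π z.1 z.2 * fderiv ℝ (Δ (newtonReg δ)) (c - z.2) e +
          evalDiag (v z.1 z.2) (fderiv ℝ (fderiv ℝ (fderiv ℝ (newtonReg δ))) (c - z.2) e)) = 0 := by
  set F : EuclideanSpace ℝ (Fin 3) → ℝ := fun c =>
    ∫ z in Ioo (0 : ℝ) T ×ˢ (univ : Set (EuclideanSpace ℝ (Fin 3))), η z.1 *
        (π z.1 z.2 * fderiv ℝ (Δ (newtonReg δ)) (c - z.2) e +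
          evalDiag (v z.1 z.2) (fderiv ℝ (fderiv ℝ (fderiv ℝ (newtonReg δ))) (c - z.2) e)) with hF
  have hFc : Continuous F := hv.continuous_pgFunctional hδ hη.continuous hηc hηT e
  have hF0 : Tendsto F (cocompact (EuclideanSpace ℝ (Fin 3))) (𝓝 0) :=
    hv.tendsto_pgFunctional_cocompact hδ hη hηc hηT e
  have hconv0 : ∀ φ : ContDiffBump (0 : EuclideanSpace ℝ (Fin 3)),
      (φ.normed volume ⋆[ContinuousLinearMap.lsmul ℝ ℝ, volume] F) = 0 := by
    intro φ
    have h2 : ContDiff ℝ 2 (φ.normed volume ⋆[ContinuousLinearMap.lsmul ℝ ℝ, volume] F) :=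
      φ.hasCompactSupport_normed.contDiff_convolution_left _ φ.contDiff_normed hFc.locallyIntegrable
    have hΔ : ∀ b, Δ (φ.normed volume ⋆[ContinuousLinearMap.lsmul ℝ ℝ, volume] F) b = 0 := fun b =>
      hv.laplacian_normed_convolution_pgFunctional_eq_zero hδ hη hηc hηT e φ b
    exact harmonic_eq_zero_of_tendsto_cocompact (harmonicOnNhd_of_laplacian_eq_zero h2 hΔ)
      (normed_convolution_tendsto_cocompact φ hF0)
  obtain ⟨φs, hφs, -⟩ := FunctionSpaces.exists_contDiffBump_seq (E := EuclideanSpace ℝ (Fin 3))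
  have hlim := ContDiffBump.convolution_tendsto_right_of_continuous (μ := volume) hφs hFc c
  have hzero : (fun n => ((φs n).normed volume ⋆[ContinuousLinearMap.lsmul ℝ ℝ, volume] F) c) =
      fun _ => (0 : ℝ) := by
    funext n
    rw [hconv0]
    rfl
  rw [hzero] at hlim
  show F c = 0
  exact (tendsto_nhds_unique tendsto_const_nhds hlim).symm

end IsLocalLeraySolutionOn

end Liouville

/-! ## Time slicing -/

section Slicing

variable {T ν : ℝ} {v₀ : EuclideanSpace ℝ (Fin 3) → EuclideanSpace ℝ (Fin 3)}
  {v : ℝ → EuclideanSpace ℝ (Fin 3) → EuclideanSpace ℝ (Fin 3)}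
  {π : ℝ → EuclideanSpace ℝ (Fin 3) → ℝ} {δ : ℝ}

namespace IsLocalLeraySolutionOn

/-- The pressure part `π(t,x) ∂ₑλ_δ(c - x)` of the slice functional is integrable on the whole
slab `(0,T) × ℝ³` (it lives on `(0,T) × B̄(c, δ)`, where `π ∈ L^{3/2} ⊂ L¹` up to the time
endpoints, clause (1) of the class). [folklore] -/
theorem integrable_pressure_term' (hv : IsLocalLeraySolutionOn T ν v₀ v π) (hδ : 0 < δ)
    (c e : EuclideanSpace ℝ (Fin 3)) :
    Integrable (fun z : ℝ × EuclideanSpace ℝ (Fin 3) =>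
        π z.1 z.2 * fderiv ℝ (Δ (newtonReg δ)) (c - z.2) e)
      (volume.restrict (Ioo (0 : ℝ) T ×ˢ (univ : Set (EuclideanSpace ℝ (Fin 3))))) := by
  obtain ⟨M₀, M₁, M₂, -, hM₁0, -, -, hM₁, -⟩ := exists_bounds_laplacian_newtonReg hδ
  set B : Set (ℝ × EuclideanSpace ℝ (Fin 3)) := Ioo (0 : ℝ) T ×ˢ closedBall c δ with hB
  have hBm : MeasurableSet B := measurableSet_Ioo.prod measurableSet_closedBall
  -- `π ∈ L^{3/2}(B) ⊂ L¹(B)`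
  have h32_0 : (3 / 2 : ℝ≥0∞) ≠ 0 := by norm_num
  have h32_t : (3 / 2 : ℝ≥0∞) ≠ ⊤ := (ENNReal.div_lt_top ENNReal.ofNat_ne_top two_ne_zero).ne
  have h32 : (3 / 2 : ℝ≥0∞).toReal = 3 / 2 := by rw [ENNReal.toReal_div]; norm_num
  have h1le : (1 : ℝ≥0∞) ≤ 3 / 2 := by
    rw [ENNReal.le_div_iff_mul_le (Or.inl two_ne_zero) (Or.inl ENNReal.ofNat_ne_top)]; norm_num
  haveI : IsFiniteMeasure ((volume : Measure (ℝ × EuclideanSpace ℝ (Fin 3))).restrict B) := by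
    refine ⟨?_⟩
    rw [Measure.restrict_apply_univ, hB, Measure.volume_eq_prod, Measure.prod_prod, Real.volume_Ioo]
    exact ENNReal.mul_lt_top ENNReal.ofReal_lt_top measure_closedBall_lt_top
  have hπm : AEStronglyMeasurable (uncurry π) ((volume : Measure (ℝ × EuclideanSpace ℝ (Fin 3))).restrict B) :=
    hv.aestronglyMeasurable_pressure.mono_measure
      (Measure.restrict_mono (prod_mono Subset.rfl (subset_univ _)) le_rfl)
  have hmem : MemLp (uncurry π) (3 / 2) ((volume : Measure (ℝ × EuclideanSpace ℝ (Fin 3))).restrict B) := by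
    refine ⟨hπm, ?_⟩
    rw [eLpNorm_eq_lintegral_rpow_enorm_toReal h32_0 h32_t, h32]
    exact ENNReal.rpow_lt_top_of_nonneg (by norm_num) (hv.pressure (closedBall c δ)
      (isCompact_closedBall _ _)).ne
  have hπB : IntegrableOn (uncurry π) B volume := hmem.integrable h1le
  -- the continuous factor and the product
  have hcont : Continuous fun z : ℝ × EuclideanSpace ℝ (Fin 3) => fderiv ℝ (Δ (newtonReg δ)) (c - z.2) e :=
    (((contDiff_laplacian_newtonReg hδ (n := 1)).continuous_fderiv one_ne_zero).comp
      (continuous_const.sub continuous_snd)).clm_apply continuous_const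
  have hbdd : ∀ z : ℝ × EuclideanSpace ℝ (Fin 3), ‖fderiv ℝ (Δ (newtonReg δ)) (c - z.2) e‖ ≤ M₁ * ‖e‖ :=
    fun z => (ContinuousLinearMap.le_opNorm _ _).trans (mul_le_mul_of_nonneg_right (hM₁ _) (norm_nonneg _))
  have hIB : IntegrableOn (fun z : ℝ × EuclideanSpace ℝ (Fin 3) =>
      π z.1 z.2 * fderiv ℝ (Δ (newtonReg δ)) (c - z.2) e) B volume := by
    have h1 : IntegrableOn (fun z : ℝ × EuclideanSpace ℝ (Fin 3) =>
        fderiv ℝ (Δ (newtonReg δ)) (c - z.2) e * uncurry π z) B volume :=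
      hπB.bdd_mul hcont.aestronglyMeasurable (ae_of_all _ hbdd)
    refine h1.congr_fun (fun z _ => ?_) hBm
    simp only [uncurry]
    ring
  refine (hIB.mono_measure Measure.restrict_le_self).integrable_of_ae_notMem_eq_zero ?_
  filter_upwards [ae_restrict_mem (measurableSet_Ioo.prod MeasurableSet.univ)] with z hz hzB
  have hx : z.2 ∉ closedBall c δ := fun h => hzB (mem_prod.2 ⟨(mem_prod.1 hz).1, h⟩)
  rw [mem_closedBall, dist_eq_norm, not_le, ← norm_sub_rev] at hx
  rw [fderiv_laplacian_newtonReg_eq_zero hδ hx, _root_.zero_apply, mul_zero]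

/-- The velocity part `D³Φ_δ(c - x)(e)(v, v)` of the slice functional is integrable on the whole
slab. [folklore] -/
theorem integrable_velocity_term' (hv : IsLocalLeraySolutionOn T ν v₀ v π) (hδ : 0 < δ)
    (c e : EuclideanSpace ℝ (Fin 3)) :
    Integrable (fun z : ℝ × EuclideanSpace ℝ (Fin 3) =>
        evalDiag (v z.1 z.2) (fderiv ℝ (fderiv ℝ (fderiv ℝ (newtonReg δ))) (c - z.2) e))
      (volume.restrict (Ioo (0 : ℝ) T ×ˢ (univ : Set (EuclideanSpace ℝ (Fin 3))))) := by
  obtain ⟨C, hC0, hC⟩ := exists_norm_fderiv3_newtonReg_le_inv hδ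
  refine Integrable.mono' ((hv.integrable_slab_weight_mul_norm_sq c).const_mul (C * ‖e‖))
    (aestronglyMeasurable_evalDiag_apply' hv.aestronglyMeasurable
      ((((continuous_fderiv3_newtonReg δ).comp (continuous_const.sub continuous_snd)).clm_apply
        continuous_const).aestronglyMeasurable)) (Eventually.of_forall fun z => ?_)
  rw [norm_sub_rev z.2 c]
  calc ‖evalDiag (v z.1 z.2) (fderiv ℝ (fderiv ℝ (fderiv ℝ (newtonReg δ))) (c - z.2) e)‖
      ≤ ‖evalDiag (v z.1 z.2)‖ * ‖fderiv ℝ (fderiv ℝ (fderiv ℝ (newtonReg δ))) (c - z.2) e‖ :=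
        ContinuousLinearMap.le_opNorm _ _
    _ ≤ ‖v z.1 z.2‖ ^ 2 * (C * ((1 + ‖c - z.2‖) ^ 4)⁻¹ * ‖e‖) := by
        refine mul_le_mul (norm_evalDiag_le _) ?_ (norm_nonneg _) (by positivity)
        exact (ContinuousLinearMap.le_opNorm _ _).trans (mul_le_mul_of_nonneg_right (hC _) (norm_nonneg _))
    _ = C * ‖e‖ * (((1 + ‖c - z.2‖) ^ 4)⁻¹ * ‖v z.1 z.2‖ ^ 2) := by ring

/-- **The slice functional vanishes for a.e. time, for one `(δ, c, e)`.** For a local Leray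
solution on the slab, `δ > 0`, a centre `c` and a direction `e`, the slice functional
`g(t) = ∫ [π(t,x) ∂ₑλ_δ(c - x) + D³Φ_δ(c - x)(e)(v(t,x), v(t,x))] dx` vanishes for a.e.
`t ∈ (0,T)` (its pairing with every `η ∈ C_c^∞((0,T))` is the functional of
`pgFunctional_eq_zero`; fundamental lemma of the calculus of variations in `t`). [folklore] -/
theorem ae_slice_pgFunctional_eq_zero (hv : IsLocalLeraySolutionOn T ν v₀ v π) (hδ : 0 < δ)
    (c e : EuclideanSpace ℝ (Fin 3)) :
    ∀ᵐ t ∂(volume.restrict (Ioo (0 : ℝ) T)),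
      ∫ x, (π t x * fderiv ℝ (Δ (newtonReg δ)) (c - x) e +
        evalDiag (v t x) (fderiv ℝ (fderiv ℝ (fderiv ℝ (newtonReg δ))) (c - x) e)) = 0 := by
  set g : ℝ → ℝ := fun t => ∫ x, (π t x * fderiv ℝ (Δ (newtonReg δ)) (c - x) e +
    evalDiag (v t x) (fderiv ℝ (fderiv ℝ (fderiv ℝ (newtonReg δ))) (c - x) e)) with hg
  -- `g` is integrable on `(0,T)`
  have hJ := (hv.integrable_pressure_term' hδ c e).add (hv.integrable_velocity_term' hδ c e)
  rw [volume_restrict_slab_eq_prod] at hJ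
  have hgi : Integrable g (volume.restrict (Ioo (0 : ℝ) T)) := by
    have h := hJ.integral_prod_left
    refine h.congr (Eventually.of_forall fun t => ?_)
    rfl
  have hgloc : LocallyIntegrableOn g (Ioo (0 : ℝ) T) volume := IntegrableOn.locallyIntegrableOn hgi
  -- the pairing with time test functions vanishes
  have hpair : ∀ η : ℝ → ℝ, ContDiff ℝ (⊤ : ℕ∞) η → HasCompactSupport η → tsupport η ⊆ Ioo 0 T →
      ∫ t, η t • g t = 0 := by
    intro η hη hηc hηT
    have h1 : ∫ t, η t • g t = ∫ t in Ioo (0 : ℝ) T, η t * g t := by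
      simp only [smul_eq_mul]
      refine (setIntegral_eq_integral_of_forall_compl_eq_zero fun t ht => ?_).symm
      rw [image_eq_zero_of_notMem_tsupport (fun h => ht (hηT h)), zero_mul]
    rw [h1, hg]
    simp only
    rw [← hv.pgFunctional_eq_integral_integral hδ hη.continuous hηc hηT c e]
    exact hv.pgFunctional_eq_zero hδ hη hηc hηT e c
  have hae := isOpen_Ioo.ae_eq_zero_of_integral_contDiff_smul_eq_zero hgloc hpair
  rw [ae_restrict_iff' measurableSet_Ioo]
  exact hae

/-- The slice functional is the value at `e` of a continuous linear functional (linearity in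
the direction). [folklore] -/
theorem slice_pgFunctional_eq_clm_apply {t : ℝ} (hδ : 0 < δ)
    (hmt : AEStronglyMeasurable (v t) volume) {A : ℝ≥0∞} (hAtop : A ≠ ⊤)
    (hA : ∀ z : EuclideanSpace ℝ (Fin 3), ∫⁻ y in ball z 1, ‖v t y‖ₑ ^ 2 ≤ A)
    (hπt : LocallyIntegrable (π t) volume) (c : EuclideanSpace ℝ (Fin 3)) :
    ∃ Λ : EuclideanSpace ℝ (Fin 3) →L[ℝ] ℝ, ∀ e : EuclideanSpace ℝ (Fin 3),
      ∫ x, (π t x * fderiv ℝ (Δ (newtonReg δ)) (c - x) e +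
        evalDiag (v t x) (fderiv ℝ (fderiv ℝ (fderiv ℝ (newtonReg δ))) (c - x) e)) = Λ e := by
  obtain ⟨Cw, hCwtop, hCw⟩ := exists_lintegral_mul_inv_one_add_norm_pow_le
  obtain ⟨C, hC0, hC⟩ := exists_norm_fderiv3_newtonReg_le_inv hδ
  -- the two operator-valued integrands
  have hL1 : Integrable (fun x => π t x • fderiv ℝ (Δ (newtonReg δ)) (c - x)) volume := by
    refine hπt.integrable_smul_right_of_hasCompactSupport ?_ ?_
    · exact ((contDiff_laplacian_newtonReg hδ (n := 1)).continuous_fderiv one_ne_zero).comp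
        (continuous_const.sub continuous_id)
    · refine HasCompactSupport.intro (isCompact_closedBall c δ) fun x hx => ?_
      rw [mem_closedBall, dist_eq_norm, not_le, ← norm_sub_rev] at hx
      exact fderiv_laplacian_newtonReg_eq_zero hδ hx
  have hL2 : Integrable (fun x => (evalDiag (v t x)).comp
      (fderiv ℝ (fderiv ℝ (fderiv ℝ (newtonReg δ))) (c - x))) volume := by
    obtain ⟨hint, -⟩ := integrable_inv_one_add_norm_pow_mul_norm_sq hCwtop hCw hmt hAtop hA c
    refine Integrable.mono' (hint.const_mul C) ?_ (Eventually.of_forall fun x => ?_)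
    · exact aestronglyMeasurable_evalDiag_comp_clm hmt
        ((continuous_fderiv3_newtonReg δ).comp (continuous_const.sub continuous_id)).aestronglyMeasurable
    · rw [norm_sub_rev x c]
      calc ‖(evalDiag (v t x)).comp (fderiv ℝ (fderiv ℝ (fderiv ℝ (newtonReg δ))) (c - x))‖
          ≤ ‖evalDiag (v t x)‖ * ‖fderiv ℝ (fderiv ℝ (fderiv ℝ (newtonReg δ))) (c - x)‖ :=
            ContinuousLinearMap.opNorm_comp_le _ _
        _ ≤ ‖v t x‖ ^ 2 * (C * ((1 + ‖c - x‖) ^ 4)⁻¹) :=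
            mul_le_mul (norm_evalDiag_le _) (hC _) (norm_nonneg _) (by positivity)
        _ = C * (((1 + ‖c - x‖) ^ 4)⁻¹ * ‖v t x‖ ^ 2) := by ring
  have hL : Integrable (fun x => π t x • fderiv ℝ (Δ (newtonReg δ)) (c - x) +
      (evalDiag (v t x)).comp (fderiv ℝ (fderiv ℝ (fderiv ℝ (newtonReg δ))) (c - x))) volume :=
    hL1.add hL2
  refine ⟨∫ x, (π t x • fderiv ℝ (Δ (newtonReg δ)) (c - x) +
    (evalDiag (v t x)).comp (fderiv ℝ (fderiv ℝ (fderiv ℝ (newtonReg δ))) (c - x))), fun e => ?_⟩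
  rw [ContinuousLinearMap.integral_apply hL e]
  refine integral_congr_ae (Eventually.of_forall fun x => ?_)
  simp only [_root_.add_apply, FunLike.coe_smul, Pi.smul_apply,
    ContinuousLinearMap.coe_comp, comp_apply, smul_eq_mul, evalDiag_apply]

/-- **The slice identities, all at once.** For a local Leray solution on the slab `(0,T) × ℝ³`
and a.e. `t ∈ (0,T)`: the slice `v(t)` is a.e.-strongly measurable with `|v(t)|² ∈ L¹_loc` and
unit-ball energies bounded by the uniformly local energy constant, `π(t) ∈ L¹_loc`, the pressure
Poisson equation holds on the slice, and for **every** `δ = 1/(n+1)`, every centre `c` and every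
direction `e`,
`∫ [π(t,x) ∂ₑλ_δ(c - x) + D³Φ_δ(c - x)(e)(v(t,x), v(t,x))] dx = 0`
(countably many `(n, c, e)` by `ae_slice_pgFunctional_eq_zero`, then all centres by continuity and
all directions by linearity). This is the slice form of "`∇π = ∇(p_loc + p_far)`" for the local
pressure expansion. [cite: KangMiuraTsai2020, Lemma 3.4 (pressure decomposition) and its proof §8] [cite: JiaSverak2014, §3 remark after Def. 1] -/
theorem ae_slice_pgIdentity (hv : IsLocalLeraySolutionOn T ν v₀ v π) :
    ∃ A : ℝ≥0, ∀ᵐ t ∂(volume.restrict (Ioo (0 : ℝ) T)),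
      AEStronglyMeasurable (v t) volume ∧
      LocallyIntegrable (fun x => ‖v t x‖ ^ 2) volume ∧
      LocallyIntegrable (π t) volume ∧
      (∀ x₀ : EuclideanSpace ℝ (Fin 3), ∫⁻ y in ball x₀ 1, ‖v t y‖ₑ ^ 2 ≤ A) ∧
      (∀ ψ : EuclideanSpace ℝ (Fin 3) → ℝ,
        FunctionSpaces.IsTestFunctionOn (⊤ : TopologicalSpace.Opens (EuclideanSpace ℝ (Fin 3))) ψ →
          ∫ x, π t x * Δ ψ x = -∫ x, fderiv ℝ (fderiv ℝ ψ) x (v t x) (v t x)) ∧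
      ∀ (n : ℕ) (c e : EuclideanSpace ℝ (Fin 3)),
        ∫ x, (π t x * fderiv ℝ (Δ (newtonReg ((n : ℝ) + 1)⁻¹)) (c - x) e +
          evalDiag (v t x)
            (fderiv ℝ (fderiv ℝ (fderiv ℝ (newtonReg ((n : ℝ) + 1)⁻¹))) (c - x) e)) = 0 := by
  obtain ⟨A, hA⟩ := hv.uniformLocalEnergy 1 one_pos
  refine ⟨A, ?_⟩
  haveI : Nonempty (EuclideanSpace ℝ (Fin 3)) := ⟨0⟩
  set q : ℕ → EuclideanSpace ℝ (Fin 3) := TopologicalSpace.denseSeq (EuclideanSpace ℝ (Fin 3)) with hq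
  have hqd : DenseRange q := TopologicalSpace.denseRange_denseSeq _
  set bs := EuclideanSpace.basisFun (Fin 3) ℝ with hbs
  have hδn : ∀ n : ℕ, (0 : ℝ) < ((n : ℝ) + 1)⁻¹ := fun n => by positivity
  -- countably many slice identities
  have hcount : ∀ᵐ t ∂(volume.restrict (Ioo (0 : ℝ) T)), ∀ (n k : ℕ) (i : Fin 3),
      ∫ x, (π t x * fderiv ℝ (Δ (newtonReg ((n : ℝ) + 1)⁻¹)) (q k - x) (bs i) +
        evalDiag (v t x)
          (fderiv ℝ (fderiv ℝ (fderiv ℝ (newtonReg ((n : ℝ) + 1)⁻¹))) (q k - x) (bs i))) = 0 := by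
    rw [ae_all_iff]; intro n
    rw [ae_all_iff]; intro k
    rw [ae_all_iff]; intro i
    exact hv.ae_slice_pgFunctional_eq_zero (hδn n) (q k) (bs i)
  filter_upwards [hcount, hv.ae_aestronglyMeasurable_slice', hv.ae_locallyIntegrable_norm_sq_slice,
    hv.ae_locallyIntegrable_pressure_slice, hA, hv.ae_slice_pressure_poisson]
    with t ht hmt hv2 hπt hAt hP
  refine ⟨hmt, hv2, hπt, hAt, hP, fun n => ?_⟩
  set δ' : ℝ := ((n : ℝ) + 1)⁻¹ with hδ'
  have hδ'0 : 0 < δ' := hδn n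
  -- the slice functional as a function of the centre and of the direction
  set G : EuclideanSpace ℝ (Fin 3) → EuclideanSpace ℝ (Fin 3) → ℝ := fun c e =>
    ∫ x, (π t x * fderiv ℝ (Δ (newtonReg δ')) (c - x) e +
      evalDiag (v t x) (fderiv ℝ (fderiv ℝ (fderiv ℝ (newtonReg δ'))) (c - x) e)) with hG
  have hAt' : ∀ z : EuclideanSpace ℝ (Fin 3), ∫⁻ y in ball z 1, ‖v t y‖ₑ ^ 2 ≤ (A : ℝ≥0∞) := hAt
  -- continuity in the centre
  have hGc : ∀ e, Continuous fun c => G c e := by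
    intro e
    have hsplit : (fun c => G c e) = fun c =>
        (π t ⋆[ContinuousLinearMap.lsmul ℝ ℝ, volume] fun w => fderiv ℝ (Δ (newtonReg δ')) w e) c +
          ∫ x, evalDiag (v t x) (fderiv ℝ (fderiv ℝ (fderiv ℝ (newtonReg δ'))) (c - x) e) := by
      funext c
      rw [hG, convolution_lsmul_apply]
      dsimp only
      rw [integral_add]
      · have hce : Continuous fun x : EuclideanSpace ℝ (Fin 3) =>
            fderiv ℝ (Δ (newtonReg δ')) (c - x) e :=
          (((contDiff_laplacian_newtonReg hδ'0 (n := 1)).continuous_fderiv one_ne_zero).comp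
            (continuous_const.sub continuous_id)).clm_apply continuous_const
        have hcs : HasCompactSupport fun x : EuclideanSpace ℝ (Fin 3) =>
            fderiv ℝ (Δ (newtonReg δ')) (c - x) e := by
          refine HasCompactSupport.intro (isCompact_closedBall c δ') fun x hx => ?_
          rw [mem_closedBall, dist_eq_norm, not_le, ← norm_sub_rev] at hx
          rw [fderiv_laplacian_newtonReg_eq_zero hδ'0 hx, _root_.zero_apply]
        have h := hπt.integrable_smul_right_of_hasCompactSupport hce hcs
        simpa only [smul_eq_mul] using h
      · exact integrable_evalDiag_fderiv3_newtonReg hδ'0 hmt ENNReal.coe_ne_top hAt' c e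
    rw [hsplit]
    refine Continuous.add ?_ (continuous_integral_evalDiag_fderiv3_newtonReg hδ'0 hmt ENNReal.coe_ne_top hAt' e)
    refine HasCompactSupport.continuous_convolution_right _ ?_ hπt ?_
    · refine HasCompactSupport.intro (isCompact_closedBall (0 : EuclideanSpace ℝ (Fin 3)) δ')
        fun x hx => ?_
      rw [mem_closedBall_zero_iff, not_le] at hx
      rw [fderiv_laplacian_newtonReg_eq_zero hδ'0 hx, _root_.zero_apply]
    · exact ((contDiff_laplacian_newtonReg hδ'0 (n := 1)).continuous_fderiv one_ne_zero).clm_apply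
        continuous_const
  -- all centres, basis directions
  have hbasis : ∀ (i : Fin 3) (c : EuclideanSpace ℝ (Fin 3)), G c (bs i) = 0 := by
    intro i
    have h := (hGc (bs i)).ext_on hqd (continuous_const (y := (0 : ℝ))) (fun c hc => ?_)
    · exact fun c => congrFun h c
    · obtain ⟨k, rfl⟩ := hc
      exact ht n k i
  -- all directions by linearity
  intro c e
  obtain ⟨Λ, hΛ⟩ := slice_pgFunctional_eq_clm_apply hδ'0 hmt ENNReal.coe_ne_top hAt' hπt c
  show G c e = 0
  have hGΛ : ∀ e, G c e = Λ e := hΛ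
  have hΛ0 : ∀ i, Λ (bs i) = 0 := fun i => (hGΛ (bs i)).symm.trans (hbasis i c)
  rw [hGΛ, ← bs.sum_repr' e, map_sum]
  refine Finset.sum_eq_zero fun i _ => ?_
  rw [map_smul, hΛ0 i, smul_zero]

end IsLocalLeraySolutionOn

end Slicing

end Literature.Analysis.FluidPDE
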